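import Literature.Topology.FourManifolds.GompfTwistedStraightening
import Literature.Topology.FourManifolds.GompfShearModel
import HarnessLib

/-!
# A straightening of a standard-form monodromy that is an explicit shear on a tube about `α`

Set-up of the geometric core of R. Gompf, *More Cappell–Shaneson spheres are standard*, Algebr.
Geom. Topol. 10 (2010), Theorem 2.1 (towards the named fact
`Literature.Topology.FourManifolds.gompf2010_framedTwist`) in the tree's straightened product
models (`Straightening`, `Straightening.prodSphere`, `GompfFramedTwistTransport.lean`; the
interface `gompf2010_framedTwist_of_prodTwistingDiffeo`, `GompfFramedTwistOfFishtail.lean`).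
Gompf's proof needs the monodromy `ψ` of `X_ψ` to be the identity near the base point `p` *and*
to carry the circle `α` through `p` into the torus `T ⊃ α` with `ψ(α) ∩ α` an arc ("we may
assume `φ` restricts to the identity in a neighborhood of some point `p`"; hypotheses of Thm 2.1).
For `A ∈ SL(3, ℤ)` in standard form (`A e₀ = e₂`, `IsGompfStandardForm`), `α` the `e₀`-circle,
`T = {z₂ = 1}` and the Dehn twist direction `c = e₂ - e₀` (the tree's `torusTwist`, `farDehn`),
this file constructs, by explicit formulas only, a straightening `tubeStraightening A` of `A`
(both straightening classes are then available through `Straightening.axisTwist`,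
`GompfAxisTwist.lean`) whose monodromy is, **on a whole tube `{|arg z₂|, |arg z₃| < r}` about
`α`, the explicit shear**
`ψ (z₁, z₂, z₃) = (z₁ · F(z₁z₃)⁻¹, z₂, z₃ · F(z₁z₃))`, `F(u) = u · e^{-i saw(u)}`
(`tubeStraightening_monodromy_apply`): in the coordinates `n = x + z` (along `α`), `ℓ = z` (along
`c`) this is `(n, y, ℓ) ↦ (n, y, ℓ + G(n))` with `e^{iG} = z₁ ↦ z₁ · shearFactor 1 z₁ 1`, the seam
function of `GompfShearModel.lean` / `FishtailSection.lean`; so `ψ(α)` is the curve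
`ℓ = G(n)` in `T`, equal to `α` where `G = 0` and winding once along `c`.

Construction (all maps are products of circle coordinates with exponentials of smooth functions
of the *unmoved* coordinates, so every stage is an explicit diffeomorphism and exactly linear in
exponential coordinates near `1`): with `L = 1 - c ⊗ n^*` (`lMat`) and `K = L A` (which fixes
`e₀`), the based diffeotopy is `D_t = (K⁻¹ ∘ E_t ∘ K) ∘ σ_t`, where `E_t` is the flow
`(n, y, ℓ) ↦ (n, y, ℓ - μ(t) saw(n))` (`eDiffeotopy`, linear part `1 - μ(t) c ⊗ n^*`, equal to
`L` at `t = 1`) and `σ_t` is a word of five coordinate shears of the normal torus of `α` and one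
shear of `α` itself (`uDiffeotopy`, `loDiffeotopy`, `nDiffeotopy`) whose time-one map is `K⁻¹` on
the tube (Gaussian elimination in `SL(2, ℤ)`, `blockWord_spec`); hence
`A ∘ D₁ = A K⁻¹ E₁ = L⁻¹ E₁` on the tube, the shear above, while `A ∘ D₁` is isotopic to `A`
through based diffeomorphisms with exactly linear germs, as `Straightening` requires.

* `Literature.Topology.FourManifolds.triShift`, `Literature.Topology.FourManifolds.shiftDiffeotopy` —
  coordinate shifts of `T³` by a smooth invariant amount, as diffeotopies;
* `Literature.Topology.FourManifolds.tubeStraightening` and its properties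
  `tubeStraightening_monodromy_apply`, `tubeStraightening_monodromy_of_tube`,
  `axisTwist_tubeStraightening_monodromy_apply` (the other class: the axis full turn is the
  identity within radius `1/2` of `α`).

Everything is proved; no named facts are introduced.

## References

* R. E. Gompf, *More Cappell–Shaneson spheres are standard*, Algebr. Geom. Topol. 10 (2010)
  1665–1681: §2 ¶1 and Thm 2.1 (hypotheses), §3 ¶1 (straightening near 0), §4 ¶2–¶3.
  [GompfAGT2010]
-/

open scoped Manifold ContDiff Topology Real
open Set Function Metric Complex

noncomputable section

namespace Literature.Topology.FourManifolds

/-- Local notation: `𝔼 n` is the model Euclidean space `EuclideanSpace ℝ (Fin n)`. -/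
local notation "𝔼 " n:arg => EuclideanSpace ℝ (Fin n)

/-- Local notation: the model with corners `𝓣 = (𝓡 1).prod ((𝓡 1).prod (𝓡 1))` of `ThreeTorus`. -/
local notation "𝓣" =>
  (ModelWithCorners.prod (𝓡 1) (ModelWithCorners.prod (𝓡 1) (𝓡 1)))

attribute [local instance] finrank_real_complex_fact'

/-! ### Vectors of `ℝ³` by coordinates -/

section Vec

/-- The vector `(a, b, c) ∈ ℝ³`. [folklore] -/
def vec3 (a b c : ℝ) : 𝔼 3 := (EuclideanSpace.equiv (Fin 3) ℝ).symm ![a, b, c]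

/-- Components of `vec3`. [folklore] -/
@[simp] theorem vec3_apply_zero (a b c : ℝ) : vec3 a b c 0 = a := rfl

/-- Components of `vec3`. [folklore] -/
@[simp] theorem vec3_apply_one (a b c : ℝ) : vec3 a b c 1 = b := rfl

/-- Components of `vec3`. [folklore] -/
@[simp] theorem vec3_apply_two (a b c : ℝ) : vec3 a b c 2 = c := rfl

/-- Every vector is `vec3` of its components. [folklore] -/
theorem vec3_eta (v : 𝔼 3) : vec3 (v 0) (v 1) (v 2) = v := by
  ext i; fin_cases i <;> rfl

/-- `expT` of `vec3`. [folklore] -/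
theorem expT_vec3 (a b c : ℝ) : expT (vec3 a b c) = (Circle.exp a, Circle.exp b, Circle.exp c) := rfl

end Vec

/-! ### Coordinate shifts of `T³` by an invariant amount -/

section Shift

/-- **The coordinate shift with exponents `(a, b, c)` by the angle `θ`**:
`(z₁, z₂, z₃) ↦ (z₁ e^{iaθ}, z₂ e^{ibθ}, z₃ e^{icθ})`. [folklore] -/
def triShift (a b c : ℝ) (θ : ℝ) (z : ThreeTorus) : ThreeTorus :=
  (z.1 * Circle.exp (a * θ), z.2.1 * Circle.exp (b * θ), z.2.2 * Circle.exp (c * θ))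

variable (a b c : ℝ)

/-- Shift by `0` is the identity. [folklore] -/
@[simp] theorem triShift_zero (z : ThreeTorus) : triShift a b c 0 z = z := by
  simp [triShift]

/-- Shifts add. [folklore] -/
theorem triShift_triShift (θ θ' : ℝ) (z : ThreeTorus) :
    triShift a b c θ (triShift a b c θ' z) = triShift a b c (θ' + θ) z := by
  simp only [triShift, mul_assoc, ← Circle.exp_add]
  refine Prod.ext ?_ (Prod.ext ?_ ?_) <;> congr 2 <;> ring

/-- **The shift in exponential coordinates**: `expT v ↦ expT (v + θ (a, b, c))`. [folklore] -/
theorem triShift_expT (θ : ℝ) (v : 𝔼 3) :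
    triShift a b c θ (expT v) = expT (v + θ • vec3 a b c) := by
  rw [← vec3_eta (v + θ • vec3 a b c), expT_vec3]
  simp only [triShift, expT, PiLp.add_apply, PiLp.smul_apply, vec3_apply_zero, vec3_apply_one,
    vec3_apply_two, smul_eq_mul, Circle.exp_add]
  refine Prod.ext ?_ (Prod.ext ?_ ?_) <;> simp [mul_comm]

variable {Q : Type*} [TopologicalSpace Q] {EQ HQ : Type*} [NormedAddCommGroup EQ] [NormedSpace ℝ EQ]
  [TopologicalSpace HQ] {IQ : ModelWithCorners ℝ EQ HQ} [ChartedSpace HQ Q]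

/-- **Smoothness of shifts by a smooth amount** of a smooth point. [folklore] -/
theorem contMDiff_triShift_of {Z : Q → ThreeTorus} {Θ : Q → ℝ} (hZ : ContMDiff IQ 𝓣 ∞ Z)
    (hΘ : ContMDiff IQ 𝓘(ℝ, ℝ) ∞ Θ) : ContMDiff IQ 𝓣 ∞ fun q ↦ triShift a b c (Θ q) (Z q) := by
  have h1 : ContMDiff IQ (𝓡 1) ∞ fun q ↦ (Z q).1 := contMDiff_fst.comp hZ
  have h2 : ContMDiff IQ (𝓡 1) ∞ fun q ↦ (Z q).2.1 := contMDiff_fst.comp (contMDiff_snd.comp hZ)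
  have h3 : ContMDiff IQ (𝓡 1) ∞ fun q ↦ (Z q).2.2 := contMDiff_snd.comp (contMDiff_snd.comp hZ)
  have he : ∀ k : ℝ, ContMDiff IQ (𝓡 1) ∞ fun q ↦ Circle.exp (k * Θ q) := fun k ↦
    contMDiff_circleExp.comp (contMDiff_const.mul hΘ)
  exact (h1.mul (he a)).prodMk ((h2.mul (he b)).prodMk (h3.mul (he c)))

variable (f : ℝ → ThreeTorus → ℝ) (hf : ContMDiff (𝓘(ℝ, ℝ).prod 𝓣) 𝓘(ℝ, ℝ) ∞ (uncurry f))
  (hinv : ∀ t θ z, f t (triShift a b c θ z) = f t z) (h0 : ∀ z, f 0 z = 0)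

/-- **The shift diffeotopy**: stages `z ↦ triShift a b c (f t z) z` for an amount `f` which is
invariant under the shift itself (a function of the unmoved coordinates), with inverse stages
`z ↦ triShift a b c (-f t z) z`. [folklore] -/
def shiftDiffeotopy : Diffeotopy 𝓣 ThreeTorus :=
  Diffeotopy.mk' 𝓣 (fun t z ↦ triShift a b c (f t z) z) (fun t z ↦ triShift a b c (-f t z) z)
    (contMDiff_triShift_of a b c contMDiff_snd hf)
    (contMDiff_triShift_of a b c contMDiff_snd hf.neg)
    (fun t z ↦ by rw [hinv, triShift_triShift, add_neg_cancel, triShift_zero])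
    (fun t z ↦ by rw [show -f t z = (-f t) z from rfl, hinv, triShift_triShift]; simp)
    (by funext z; rw [h0, triShift_zero]; rfl)

/-- Stages of the shift diffeotopy (definitional). [folklore] -/
@[simp] theorem shiftDiffeotopy_toFun (t : ℝ) (z : ThreeTorus) :
    (shiftDiffeotopy a b c f hf hinv h0).toFun t z = triShift a b c (f t z) z := rfl

/-- Inverse stages of the shift diffeotopy (definitional). [folklore] -/
@[simp] theorem shiftDiffeotopy_invFun (t : ℝ) (z : ThreeTorus) :
    (shiftDiffeotopy a b c f hf hinv h0).invFun t z = triShift a b c (-f t z) z := rfl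

end Shift

/-! ### The time profile and the saw-tooth argument in exponential coordinates -/

section Profile

/-- The clamped time `μ = Real.smoothTransition` (`0` for `t ≤ 0`, `1` for `t ≥ 1`), so that all
coefficients stay bounded for every real `t`. [folklore] -/
abbrev μT (t : ℝ) : ℝ := Real.smoothTransition t

/-- `|μ t| ≤ 1`. [folklore] -/
theorem abs_μT_le (t : ℝ) : |μT t| ≤ 1 := by
  rw [abs_of_nonneg (Real.smoothTransition.nonneg t)]
  exact Real.smoothTransition.le_one t

/-- **The saw-tooth argument of an exponential**: `saw (e^{iθ}) = θ` for `|θ| < 1`. [folklore] -/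
theorem sawArg_exp_of_abs_lt {θ : ℝ} (h : |θ| < 1) : sawArg (Circle.exp θ) = θ :=
  sawArg_exp (by linarith [(abs_lt.1 h).1, Real.pi_gt_three]) (abs_lt.1 h).2.le

end Profile

/-! ### The four explicit families -/

section Families

/-- Smoothness of `(t, z) ↦ μ(t) · k · saw(coordinate)` for a smooth circle-valued coordinate. [folklore] -/
theorem contMDiff_mu_mul_saw {g : ThreeTorus → Circle} (hg : ContMDiff 𝓣 (𝓡 1) ∞ g) (k : ℝ) :
    ContMDiff (𝓘(ℝ, ℝ).prod 𝓣) 𝓘(ℝ, ℝ) ∞ fun p : ℝ × ThreeTorus ↦ μT p.1 * k * sawArg (g p.2) :=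
  (((Real.smoothTransition.contDiff).comp_contMDiff contMDiff_fst).mul contMDiff_const).mul
    (contMDiff_sawArg.comp (hg.comp contMDiff_snd))

/-- **The flow `E_t`**: `(n, y, ℓ) ↦ (n, y, ℓ - μ(t) saw(n))`, i.e.
`(z₁, z₂, z₃) ↦ (z₁ e^{iθ}, z₂, z₃ e^{-iθ})`, `θ = μ(t) saw(z₁ z₃)` (`z₁ z₃ = e^{in}` is unmoved). [cite: GompfAGT2010, §3 ¶1 (straightening the linear diffeomorphism near 0)] -/
def eDiffeotopy : Diffeotopy 𝓣 ThreeTorus :=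
  shiftDiffeotopy 1 0 (-1) (fun t z ↦ μT t * 1 * sawArg (z.1 * z.2.2))
    (contMDiff_mu_mul_saw (contMDiff_fst.mul (contMDiff_snd.comp contMDiff_snd)) 1)
    (fun t θ z ↦ by
      simp only [triShift, one_mul, neg_mul, Circle.exp_neg, mul_one]
      rw [mul_mul_mul_comm, mul_inv_cancel, mul_one])
    (fun z ↦ by simp [μT, Real.smoothTransition.zero_of_nonpos le_rfl])

/-- **The shear of `y` by `ℓ`**: `(z₁, z₂, z₃) ↦ (z₁, z₂ e^{i μ(t) k saw(z₃)}, z₃)`. [folklore] -/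
def uDiffeotopy (k : ℝ) : Diffeotopy 𝓣 ThreeTorus :=
  shiftDiffeotopy 0 1 0 (fun t z ↦ μT t * k * sawArg z.2.2)
    (contMDiff_mu_mul_saw (contMDiff_snd.comp contMDiff_snd) k)
    (fun t θ z ↦ by simp [triShift])
    (fun z ↦ by simp [μT, Real.smoothTransition.zero_of_nonpos le_rfl])

/-- **The shear of `ℓ` by `y` at constant `n`**: `(z₁, z₂, z₃) ↦ (z₁ e^{-iθ}, z₂, z₃ e^{iθ})`,
`θ = μ(t) k saw(z₂)` (a `torusTwist`). [folklore] -/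
def loDiffeotopy (k : ℝ) : Diffeotopy 𝓣 ThreeTorus :=
  shiftDiffeotopy (-1) 0 1 (fun t z ↦ μT t * k * sawArg z.2.1)
    (contMDiff_mu_mul_saw (contMDiff_fst.comp contMDiff_snd) k)
    (fun t θ z ↦ by simp [triShift])
    (fun z ↦ by simp [μT, Real.smoothTransition.zero_of_nonpos le_rfl])

/-- **The shear of `n` by `(y, ℓ)`**: `(z₁, z₂, z₃) ↦ (z₁ e^{i μ(t)(a saw z₂ + b saw z₃)}, z₂, z₃)`. [folklore] -/
def nDiffeotopy (a b : ℝ) : Diffeotopy 𝓣 ThreeTorus :=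
  shiftDiffeotopy 1 0 0 (fun t z ↦ μT t * a * sawArg z.2.1 + μT t * b * sawArg z.2.2)
    ((contMDiff_mu_mul_saw (contMDiff_fst.comp contMDiff_snd) a).add
      (contMDiff_mu_mul_saw (contMDiff_snd.comp contMDiff_snd) b))
    (fun t θ z ↦ by simp [triShift])
    (fun z ↦ by simp [μT, Real.smoothTransition.zero_of_nonpos le_rfl])

/-! #### Their linear parts -/

/-- Linear part of `E_t`: `1 - s c ⊗ n^*`, `s = μ(t)`. [folklore] -/
def eMat (s : ℝ) : Matrix (Fin 3) (Fin 3) ℝ := !![1 + s, 0, s; 0, 1, 0; -s, 0, 1 - s]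

/-- Linear part of the `y`-shear. [folklore] -/
def uMat (s : ℝ) : Matrix (Fin 3) (Fin 3) ℝ := !![1, 0, 0; 0, 1, s; 0, 0, 1]

/-- Linear part of the `ℓ`-shear at constant `n`. [folklore] -/
def loMat (s : ℝ) : Matrix (Fin 3) (Fin 3) ℝ := !![1, -s, 0; 0, 1, 0; 0, s, 1]

/-- Linear part of the `n`-shear. [folklore] -/
def nMat (a b : ℝ) : Matrix (Fin 3) (Fin 3) ℝ := !![1, a, b; 0, 1, 0; 0, 0, 1]

/-- Coordinates of `eMat s v`. [folklore] -/
theorem mulVecE_eMat (s : ℝ) (v : 𝔼 3) :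
    mulVecE (eMat s) v = v + (s * (v 0 + v 2)) • vec3 1 0 (-1) := by
  ext i
  rw [mulVecE_apply, Fin.sum_univ_three]
  fin_cases i
  · simp [eMat]; ring
  · simp [eMat]
  · simp [eMat]; ring

/-- Coordinates of `uMat s v`. [folklore] -/
theorem mulVecE_uMat (s : ℝ) (v : 𝔼 3) : mulVecE (uMat s) v = v + (s * v 2) • vec3 0 1 0 := by
  ext i
  rw [mulVecE_apply, Fin.sum_univ_three]
  fin_cases i
  · simp [uMat]
  · simp [uMat]
  · simp [uMat]

/-- Coordinates of `loMat s v`. [folklore] -/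
theorem mulVecE_loMat (s : ℝ) (v : 𝔼 3) : mulVecE (loMat s) v = v + (s * v 1) • vec3 (-1) 0 1 := by
  ext i
  rw [mulVecE_apply, Fin.sum_univ_three]
  fin_cases i
  · simp [loMat]
  · simp [loMat]
  · simp [loMat]; ring

/-- Coordinates of `nMat a b v`. [folklore] -/
theorem mulVecE_nMat (a b : ℝ) (v : 𝔼 3) :
    mulVecE (nMat a b) v = v + (a * v 1 + b * v 2) • vec3 1 0 0 := by
  ext i
  rw [mulVecE_apply, Fin.sum_univ_three]
  fin_cases i
  · simp [nMat]; ring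
  · simp [nMat]
  · simp [nMat]

/-- `eMat s * eMat (-s) = 1` (`(c ⊗ n^*)² = 0`). [folklore] -/
theorem eMat_mul_neg (s : ℝ) : eMat s * eMat (-s) = 1 := by
  ext i j; fin_cases i <;> fin_cases j <;> simp [eMat, Matrix.mul_apply, Fin.sum_univ_three] <;> ring

/-- `uMat s * uMat (-s) = 1`. [folklore] -/
theorem uMat_mul_neg (s : ℝ) : uMat s * uMat (-s) = 1 := by
  ext i j; fin_cases i <;> fin_cases j <;> simp [uMat, Matrix.mul_apply, Fin.sum_univ_three]

/-- `loMat s * loMat (-s) = 1`. [folklore] -/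
theorem loMat_mul_neg (s : ℝ) : loMat s * loMat (-s) = 1 := by
  ext i j; fin_cases i <;> fin_cases j <;> simp [loMat, Matrix.mul_apply, Fin.sum_univ_three]

/-- `nMat a b * nMat (-a) (-b) = 1`. [folklore] -/
theorem nMat_mul_neg (a b : ℝ) : nMat a b * nMat (-a) (-b) = 1 := by
  ext i j; fin_cases i <;> fin_cases j <;> simp [nMat, Matrix.mul_apply, Fin.sum_univ_three]

/-- `eMat 0 = 1`. [folklore] -/
@[simp] theorem eMat_zero : eMat 0 = 1 := by
  ext i j; fin_cases i <;> fin_cases j <;> simp [eMat]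

/-- `uMat 0 = 1`. [folklore] -/
@[simp] theorem uMat_zero : uMat 0 = 1 := by
  ext i j; fin_cases i <;> fin_cases j <;> simp [uMat]

/-- `loMat 0 = 1`. [folklore] -/
@[simp] theorem loMat_zero : loMat 0 = 1 := by
  ext i j; fin_cases i <;> fin_cases j <;> simp [loMat]

/-- `nMat 0 0 = 1`. [folklore] -/
@[simp] theorem nMat_zero : nMat 0 0 = 1 := by
  ext i j; fin_cases i <;> fin_cases j <;> simp [nMat]

/-- Entries of `eMat` are affine in `s`. [folklore] -/
theorem contDiff_eMat_apply {φ : ℝ → ℝ} (hφ : ContDiff ℝ ∞ φ) (i j : Fin 3) :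
    ContDiff ℝ ∞ fun t ↦ eMat (φ t) i j := by
  fin_cases i <;> fin_cases j <;> simp [eMat] <;> fun_prop

/-- Entries of `uMat` are affine in `s`. [folklore] -/
theorem contDiff_uMat_apply {φ : ℝ → ℝ} (hφ : ContDiff ℝ ∞ φ) (i j : Fin 3) :
    ContDiff ℝ ∞ fun t ↦ uMat (φ t) i j := by
  fin_cases i <;> fin_cases j <;> simp [uMat] <;> fun_prop

/-- Entries of `loMat` are affine in `s`. [folklore] -/
theorem contDiff_loMat_apply {φ : ℝ → ℝ} (hφ : ContDiff ℝ ∞ φ) (i j : Fin 3) :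
    ContDiff ℝ ∞ fun t ↦ loMat (φ t) i j := by
  fin_cases i <;> fin_cases j <;> simp [loMat] <;> fun_prop

/-- Entries of `nMat` are affine in the parameters. [folklore] -/
theorem contDiff_nMat_apply {φ χ : ℝ → ℝ} (hφ : ContDiff ℝ ∞ φ) (hχ : ContDiff ℝ ∞ χ) (i j : Fin 3) :
    ContDiff ℝ ∞ fun t ↦ nMat (φ t) (χ t) i j := by
  fin_cases i <;> fin_cases j <;> simp [nMat] <;> fun_prop

/-! #### Exact linearity of the stages on the cube `|vᵢ| < 1/2` -/

/-- `E_t (expT v) = expT (eMat (μ t) v)` for `|v₀|, |v₂| < 1/2`. [folklore] -/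
theorem eDiffeotopy_toFun_expT (t : ℝ) {v : 𝔼 3} (h0 : |v 0| < 1 / 2) (h2 : |v 2| < 1 / 2) :
    eDiffeotopy.toFun t (expT v) = expT (mulVecE (eMat (μT t)) v) := by
  have hn : sawArg (Circle.exp (v 0) * Circle.exp (v 2)) = v 0 + v 2 := by
    rw [← Circle.exp_add]
    exact sawArg_exp_of_abs_lt (by
      have := abs_add_le (v 0) (v 2); linarith)
  rw [eDiffeotopy, shiftDiffeotopy_toFun, mulVecE_eMat, ← triShift_expT]
  show triShift 1 0 (-1) (μT t * 1 * sawArg (Circle.exp (v 0) * Circle.exp (v 2))) (expT v) = _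
  rw [hn, mul_one]

/-- `E_t⁻¹ (expT v) = expT (eMat (-μ t) v)` for `|v₀|, |v₂| < 1/2`. [folklore] -/
theorem eDiffeotopy_invFun_expT (t : ℝ) {v : 𝔼 3} (h0 : |v 0| < 1 / 2) (h2 : |v 2| < 1 / 2) :
    eDiffeotopy.invFun t (expT v) = expT (mulVecE (eMat (-μT t)) v) := by
  have hn : sawArg (Circle.exp (v 0) * Circle.exp (v 2)) = v 0 + v 2 := by
    rw [← Circle.exp_add]
    exact sawArg_exp_of_abs_lt (by
      have := abs_add_le (v 0) (v 2); linarith)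
  rw [eDiffeotopy, shiftDiffeotopy_invFun, mulVecE_eMat, ← triShift_expT]
  show triShift 1 0 (-1) (-(μT t * 1 * sawArg (Circle.exp (v 0) * Circle.exp (v 2)))) (expT v) = _
  rw [hn, mul_one, neg_mul]

/-- `U_t (expT v) = expT (uMat (μ t k) v)` for `|v₂| < 1`. [folklore] -/
theorem uDiffeotopy_toFun_expT (k t : ℝ) {v : 𝔼 3} (h2 : |v 2| < 1) :
    (uDiffeotopy k).toFun t (expT v) = expT (mulVecE (uMat (μT t * k)) v) := by
  rw [uDiffeotopy, shiftDiffeotopy_toFun, mulVecE_uMat, ← triShift_expT]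
  show triShift 0 1 0 (μT t * k * sawArg (Circle.exp (v 2))) (expT v) = _
  rw [sawArg_exp_of_abs_lt h2]

/-- `U_t⁻¹ (expT v) = expT (uMat (-μ t k) v)` for `|v₂| < 1`. [folklore] -/
theorem uDiffeotopy_invFun_expT (k t : ℝ) {v : 𝔼 3} (h2 : |v 2| < 1) :
    (uDiffeotopy k).invFun t (expT v) = expT (mulVecE (uMat (-(μT t * k))) v) := by
  rw [uDiffeotopy, shiftDiffeotopy_invFun, mulVecE_uMat, ← triShift_expT]
  show triShift 0 1 0 (-(μT t * k * sawArg (Circle.exp (v 2)))) (expT v) = _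
  rw [sawArg_exp_of_abs_lt h2, neg_mul]

/-- `Lo_t (expT v) = expT (loMat (μ t k) v)` for `|v₁| < 1`. [folklore] -/
theorem loDiffeotopy_toFun_expT (k t : ℝ) {v : 𝔼 3} (h1 : |v 1| < 1) :
    (loDiffeotopy k).toFun t (expT v) = expT (mulVecE (loMat (μT t * k)) v) := by
  rw [loDiffeotopy, shiftDiffeotopy_toFun, mulVecE_loMat, ← triShift_expT]
  show triShift (-1) 0 1 (μT t * k * sawArg (Circle.exp (v 1))) (expT v) = _
  rw [sawArg_exp_of_abs_lt h1]

/-- `Lo_t⁻¹ (expT v) = expT (loMat (-μ t k) v)` for `|v₁| < 1`. [folklore] -/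
theorem loDiffeotopy_invFun_expT (k t : ℝ) {v : 𝔼 3} (h1 : |v 1| < 1) :
    (loDiffeotopy k).invFun t (expT v) = expT (mulVecE (loMat (-(μT t * k))) v) := by
  rw [loDiffeotopy, shiftDiffeotopy_invFun, mulVecE_loMat, ← triShift_expT]
  show triShift (-1) 0 1 (-(μT t * k * sawArg (Circle.exp (v 1)))) (expT v) = _
  rw [sawArg_exp_of_abs_lt h1, neg_mul]

/-- `N_t (expT v) = expT (nMat (μ t a) (μ t b) v)` for `|v₁|, |v₂| < 1`. [folklore] -/
theorem nDiffeotopy_toFun_expT (a b t : ℝ) {v : 𝔼 3} (h1 : |v 1| < 1) (h2 : |v 2| < 1) :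
    (nDiffeotopy a b).toFun t (expT v) = expT (mulVecE (nMat (μT t * a) (μT t * b)) v) := by
  rw [nDiffeotopy, shiftDiffeotopy_toFun, mulVecE_nMat, ← triShift_expT]
  show triShift 1 0 0 (μT t * a * sawArg (Circle.exp (v 1)) + μT t * b * sawArg (Circle.exp (v 2)))
    (expT v) = _
  rw [sawArg_exp_of_abs_lt h1, sawArg_exp_of_abs_lt h2]

/-- `N_t⁻¹ (expT v) = expT (nMat (-μ t a) (-μ t b) v)` for `|v₁|, |v₂| < 1`. [folklore] -/
theorem nDiffeotopy_invFun_expT (a b t : ℝ) {v : 𝔼 3} (h1 : |v 1| < 1) (h2 : |v 2| < 1) :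
    (nDiffeotopy a b).invFun t (expT v) = expT (mulVecE (nMat (-(μT t * a)) (-(μT t * b))) v) := by
  rw [nDiffeotopy, shiftDiffeotopy_invFun, mulVecE_nMat, ← triShift_expT]
  show triShift 1 0 0 (-(μT t * a * sawArg (Circle.exp (v 1)) + μT t * b * sawArg (Circle.exp (v 2))))
    (expT v) = _
  rw [sawArg_exp_of_abs_lt h1, sawArg_exp_of_abs_lt h2]
  congr 2; ring

end Families

/-! ### Standard form: `L = 1 - c ⊗ n^*`, `K = L A` fixes `e₀`, and `K⁻¹` as a word of shears -/

section Algebra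

/-- **`L = 1 - c ⊗ n^*`** (`c = e₂ - e₀`, `n^* = e₀^* + e₂^*`): `(n, y, ℓ) ↦ (n, y, ℓ - n)`. [cite: GompfAGT2010, §3 (standard form)] -/
def lMat : Matrix.SpecialLinearGroup (Fin 3) ℤ := ⟨!![2, 0, 1; 0, 1, 0; -1, 0, 0], by decide⟩

/-- `L⁻¹ = 1 + c ⊗ n^*`. [folklore] -/
def lMatInv : Matrix.SpecialLinearGroup (Fin 3) ℤ := ⟨!![0, 0, -1; 0, 1, 0; 1, 0, 2], by decide⟩

/-- `L * L⁻¹ = 1`. [folklore] -/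
theorem lMat_mul_lMatInv : lMat * lMatInv = 1 := by
  apply Subtype.ext
  rw [Matrix.SpecialLinearGroup.coe_mul, Matrix.SpecialLinearGroup.coe_one]
  decide

/-- `lMat⁻¹ = lMatInv`. [folklore] -/
theorem lMat_inv : lMat⁻¹ = lMatInv :=
  inv_eq_of_mul_eq_one_right lMat_mul_lMatInv

/-- The real matrix of `L` is `eMat 1`. [folklore] -/
theorem slRealMatrix_lMat : slRealMatrix lMat = eMat 1 := by
  ext i j
  fin_cases i <;> fin_cases j <;> norm_num [lMat, eMat]

variable (A : Matrix.SpecialLinearGroup (Fin 3) ℤ)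

/-- **`K = L A`**, which fixes `e₀` when `A` is in standard form. [cite: GompfAGT2010, §3 (standard form A e₁ = e₃)] -/
def kMat : Matrix.SpecialLinearGroup (Fin 3) ℤ := lMat * A

/-- `A K⁻¹ = L⁻¹`. [folklore] -/
theorem mul_kMat_inv : A * (kMat A)⁻¹ = lMatInv := by
  rw [kMat, mul_inv_rev, ← mul_assoc, mul_inv_cancel, one_mul, lMat_inv]

/-- `K⁻¹ L = A⁻¹`. [folklore] -/
theorem kMat_inv_mul_lMat : (kMat A)⁻¹ * lMat = A⁻¹ := by
  rw [kMat, mul_inv_rev, mul_assoc, inv_mul_cancel, mul_one]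

variable {A}

/-- The first column of `K` is `e₀`. [folklore] -/
theorem kMat_apply_zero (hA : IsGompfStandardForm A) (i : Fin 3) :
    ((kMat A : Matrix.SpecialLinearGroup (Fin 3) ℤ) : Matrix (Fin 3) (Fin 3) ℤ) i 0 = if i = 0 then 1 else 0 := by
  obtain ⟨h0, h1, h2⟩ := hA
  rw [kMat, Matrix.SpecialLinearGroup.coe_mul, Matrix.mul_apply, Fin.sum_univ_three, h0, h1, h2]
  fin_cases i <;> simp [lMat]

/-- **The first column of `K⁻¹` is `e₀`.** [folklore] -/
theorem kMat_inv_apply_zero (hA : IsGompfStandardForm A) (i : Fin 3) :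
    (((kMat A)⁻¹ : Matrix.SpecialLinearGroup (Fin 3) ℤ) : Matrix (Fin 3) (Fin 3) ℤ) i 0 =
      if i = 0 then 1 else 0 := by
  have h : ((((kMat A)⁻¹ : Matrix.SpecialLinearGroup (Fin 3) ℤ) : Matrix (Fin 3) (Fin 3) ℤ) *
      ((kMat A : Matrix.SpecialLinearGroup (Fin 3) ℤ) : Matrix (Fin 3) (Fin 3) ℤ)) i 0 =
      (1 : Matrix (Fin 3) (Fin 3) ℤ) i 0 := by
    rw [← Matrix.SpecialLinearGroup.coe_mul, inv_mul_cancel, Matrix.SpecialLinearGroup.coe_one]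
  rw [Matrix.mul_apply, Fin.sum_univ_three, kMat_apply_zero hA, kMat_apply_zero hA,
    kMat_apply_zero hA] at h
  simp only [Fin.isValue, ↓reduceIte, mul_one, one_ne_zero, mul_zero, add_zero,
    show (2 : Fin 3) ≠ 0 by decide] at h
  rw [h, Matrix.one_apply]

variable (A) in
/-- Entries of `K⁻¹` (integers), abbreviation. [folklore] -/
abbrev kInv (i j : Fin 3) : ℤ := (((kMat A)⁻¹ : Matrix.SpecialLinearGroup (Fin 3) ℤ) : Matrix (Fin 3) (Fin 3) ℤ) i j

/-- **The normal block of `K⁻¹` has determinant one**: `p s - q r = 1`. [folklore] -/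
theorem kInv_block_det (hA : IsGompfStandardForm A) :
    kInv A 1 1 * kInv A 2 2 - kInv A 1 2 * kInv A 2 1 = 1 := by
  have hdet : (((kMat A)⁻¹ : Matrix.SpecialLinearGroup (Fin 3) ℤ) : Matrix (Fin 3) (Fin 3) ℤ).det = 1 :=
    Matrix.SpecialLinearGroup.det_coe _
  rw [Matrix.det_fin_three] at hdet
  have h0 := kMat_inv_apply_zero hA 0
  have h1 := kMat_inv_apply_zero hA 1
  have h2 := kMat_inv_apply_zero hA 2
  simp only [Fin.isValue, ↓reduceIte, one_ne_zero, show (2 : Fin 3) ≠ 0 by decide] at h0 h1 h2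
  unfold kInv
  rw [h0, h1, h2] at hdet
  linarith

/-! #### Gaussian elimination in `SL(2, ℤ)` with a fixed word `U L U L U` -/

/-- The word of five coordinate shears (real coefficients). [folklore] -/
def blockWord (a₁ b₁ a₂ b₂ a₃ : ℝ) : Matrix (Fin 3) (Fin 3) ℝ :=
  uMat a₁ * loMat b₁ * uMat a₂ * loMat b₂ * uMat a₃

/-- The first column of the word is `e₀`; its normal block is explicit. [folklore] -/
theorem blockWord_entries (a₁ b₁ a₂ b₂ a₃ : ℝ) :
    blockWord a₁ b₁ a₂ b₂ a₃ 0 0 = 1 ∧ blockWord a₁ b₁ a₂ b₂ a₃ 1 0 = 0 ∧ blockWord a₁ b₁ a₂ b₂ a₃ 2 0 = 0 ∧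
    blockWord a₁ b₁ a₂ b₂ a₃ 1 1 = (1 + a₁ * b₁) + ((1 + a₁ * b₁) * a₂ + a₁) * b₂ ∧
    blockWord a₁ b₁ a₂ b₂ a₃ 1 2 = ((1 + a₁ * b₁) + ((1 + a₁ * b₁) * a₂ + a₁) * b₂) * a₃ +
      ((1 + a₁ * b₁) * a₂ + a₁) ∧
    blockWord a₁ b₁ a₂ b₂ a₃ 2 1 = b₁ + (b₁ * a₂ + 1) * b₂ ∧
    blockWord a₁ b₁ a₂ b₂ a₃ 2 2 = (b₁ + (b₁ * a₂ + 1) * b₂) * a₃ + (b₁ * a₂ + 1) := by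
  simp only [blockWord, uMat, loMat, Matrix.mul_apply, Fin.sum_univ_three]
  simp

variable (A)

/-- The five coefficients of the word realising the normal block `[[p, q], [r, s]]` of `K⁻¹`
(case `r ≠ 0`: `U((p-1)/r) L(r) U((s-1)/r)`; case `r = 0, p = 1`: `U(q)`; case `r = 0, p = -1`:
`-1 · U(-q) = U(1) L(-1) U(2) L(-1) U(1-q)`). [folklore] -/
def wordCoef : Fin 5 → ℝ := fun m ↦
  if kInv A 2 1 ≠ 0 then
    ![((kInv A 1 1 : ℝ) - 1) / kInv A 2 1, (kInv A 2 1 : ℝ), ((kInv A 2 2 : ℝ) - 1) / kInv A 2 1, 0, 0] m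
  else if kInv A 1 1 = 1 then ![(kInv A 1 2 : ℝ), 0, 0, 0, 0] m
  else ![1, -1, 2, -1, 1 - (kInv A 1 2 : ℝ)] m

/-- The word of `K⁻¹`. [folklore] -/
def kWord : Matrix (Fin 3) (Fin 3) ℝ :=
  blockWord (wordCoef A 0) (wordCoef A 1) (wordCoef A 2) (wordCoef A 3) (wordCoef A 4)

/-- The coefficients of the `n`-shear: the top row of `K⁻¹` minus the top row of the word. [folklore] -/
def nCoef (j : Fin 3) : ℝ := (kInv A 0 j : ℝ) - kWord A 0 j

variable {A}

/-- **The word times the `n`-shear is `K⁻¹`** (as real matrices). [folklore] -/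
theorem kWord_mul_nMat (hA : IsGompfStandardForm A) :
    kWord A * nMat (nCoef A 1) (nCoef A 2) = slRealMatrix (kMat A)⁻¹ := by
  obtain ⟨e00, e10, e20, e11, e12, e21, e22⟩ :=
    blockWord_entries (wordCoef A 0) (wordCoef A 1) (wordCoef A 2) (wordCoef A 3) (wordCoef A 4)
  have hdet := kInv_block_det hA
  have c0 := kMat_inv_apply_zero hA 0
  have c1 := kMat_inv_apply_zero hA 1
  have c2 := kMat_inv_apply_zero hA 2
  simp only [Fin.isValue, ↓reduceIte, one_ne_zero, show (2 : Fin 3) ≠ 0 by decide] at c0 c1 c2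
  -- the normal block of the word is `[[p, q], [r, s]]`
  have hblock : kWord A 1 1 = kInv A 1 1 ∧ kWord A 1 2 = kInv A 1 2 ∧ kWord A 2 1 = kInv A 2 1 ∧
      kWord A 2 2 = kInv A 2 2 := by
    unfold kWord
    rw [e11, e12, e21, e22]
    by_cases hr : kInv A 2 1 ≠ 0
    · have hr' : (kInv A 2 1 : ℝ) ≠ 0 := by exact_mod_cast hr
      have hdet' : (kInv A 1 1 : ℝ) * kInv A 2 2 - kInv A 1 2 * kInv A 2 1 = 1 := by exact_mod_cast hdet
      have hc : wordCoef A 0 = ((kInv A 1 1 : ℝ) - 1) / kInv A 2 1 ∧ wordCoef A 1 = kInv A 2 1 ∧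
          wordCoef A 2 = ((kInv A 2 2 : ℝ) - 1) / kInv A 2 1 ∧ wordCoef A 3 = 0 ∧ wordCoef A 4 = 0 := by
        simp [wordCoef, if_pos hr]
      obtain ⟨h0, h1, h2, h3, h4⟩ := hc
      rw [h0, h1, h2, h3, h4]
      refine ⟨?_, ?_, ?_, ?_⟩
      · field_simp; ring
      · rw [mul_zero, zero_add]
        field_simp
        linear_combination hdet'
      · ring
      · field_simp; ring
    · push Not at hr
      have hps : kInv A 1 1 * kInv A 2 2 = 1 := by rw [hr, mul_zero, sub_zero] at hdet; exact hdet
      rcases Int.eq_one_or_neg_one_of_mul_eq_one hps with hp | hp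
      · have hs : kInv A 2 2 = 1 := by rw [hp, one_mul] at hps; exact hps
        have hc : wordCoef A 0 = kInv A 1 2 ∧ wordCoef A 1 = 0 ∧ wordCoef A 2 = 0 ∧ wordCoef A 3 = 0 ∧
            wordCoef A 4 = 0 := by
          simp [wordCoef, hr, hp]
        obtain ⟨h0, h1, h2, h3, h4⟩ := hc
        rw [h0, h1, h2, h3, h4, hp, hs, hr]
        push_cast
        refine ⟨by ring, by ring, by ring, by ring⟩
      · have hs : kInv A 2 2 = -1 := by rw [hp] at hps; linarith
        have hp1 : kInv A 1 1 ≠ 1 := by rw [hp]; norm_num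
        have hc : wordCoef A 0 = 1 ∧ wordCoef A 1 = -1 ∧ wordCoef A 2 = 2 ∧ wordCoef A 3 = -1 ∧
            wordCoef A 4 = 1 - kInv A 1 2 := by
          simp [wordCoef, hr, hp1]
        obtain ⟨h0, h1, h2, h3, h4⟩ := hc
        rw [h0, h1, h2, h3, h4, hp, hs, hr]
        push_cast
        refine ⟨by ring, by ring, by ring, by ring⟩
  obtain ⟨b11, b12, b21, b22⟩ := hblock
  have w00 : kWord A 0 0 = 1 := e00
  have w10 : kWord A 1 0 = 0 := e10
  have w20 : kWord A 2 0 = 0 := e20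
  ext i j
  rw [Matrix.mul_apply, Fin.sum_univ_three, slRealMatrix_apply]
  fin_cases i <;> fin_cases j
  · simp [nMat, w00, c0]
  · simp [nMat, w00, nCoef, kInv, Matrix.SpecialLinearGroup.coe_inv]
  · simp [nMat, w00, nCoef, kInv, Matrix.SpecialLinearGroup.coe_inv]
  · simp [nMat, w10, c1]
  · simp [nMat, w10, b11, kInv, Matrix.SpecialLinearGroup.coe_inv]
  · simp [nMat, w10, b12, kInv, Matrix.SpecialLinearGroup.coe_inv]
  · simp [nMat, w20, c2]
  · simp [nMat, w20, b21, kInv, Matrix.SpecialLinearGroup.coe_inv]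
  · simp [nMat, w20, b22, kInv, Matrix.SpecialLinearGroup.coe_inv]

end Algebra

/-! ### Bounds -/

section Bounds

variable (A : Matrix.SpecialLinearGroup (Fin 3) ℤ)

/-- **The master bound `B`** for all coefficients and matrix entries met (`≥ 2`). [folklore] -/
def tsBound : ℝ :=
  2 + ∑ m, |wordCoef A m| + |nCoef A 1| + |nCoef A 2| +
    ∑ i, ∑ j, |slRealMatrix (kMat A) i j| + ∑ i, ∑ j, |slRealMatrix (kMat A)⁻¹ i j|

/-- `2 ≤ B`. [folklore] -/
theorem two_le_tsBound : 2 ≤ tsBound A := by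
  unfold tsBound
  have h1 : 0 ≤ ∑ m, |wordCoef A m| := Finset.sum_nonneg fun _ _ ↦ abs_nonneg _
  have h2 : 0 ≤ ∑ i, ∑ j, |slRealMatrix (kMat A) i j| :=
    Finset.sum_nonneg fun _ _ ↦ Finset.sum_nonneg fun _ _ ↦ abs_nonneg _
  have h3 : 0 ≤ ∑ i, ∑ j, |slRealMatrix (kMat A)⁻¹ i j| :=
    Finset.sum_nonneg fun _ _ ↦ Finset.sum_nonneg fun _ _ ↦ abs_nonneg _
  have h4 := abs_nonneg (nCoef A 1)
  have h5 := abs_nonneg (nCoef A 2)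
  linarith

/-- `1 ≤ B`. [folklore] -/
theorem one_le_tsBound : 1 ≤ tsBound A := by linarith [two_le_tsBound A]

/-- `0 < B`. [folklore] -/
theorem tsBound_pos : 0 < tsBound A := by linarith [two_le_tsBound A]

/-- `|wordCoef m| ≤ B`. [folklore] -/
theorem abs_wordCoef_le (m : Fin 5) : |wordCoef A m| ≤ tsBound A := by
  unfold tsBound
  have h1 : |wordCoef A m| ≤ ∑ m, |wordCoef A m| :=
    Finset.single_le_sum (f := fun m ↦ |wordCoef A m|) (fun _ _ ↦ abs_nonneg _) (Finset.mem_univ m)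
  have h2 : 0 ≤ ∑ i, ∑ j, |slRealMatrix (kMat A) i j| :=
    Finset.sum_nonneg fun _ _ ↦ Finset.sum_nonneg fun _ _ ↦ abs_nonneg _
  have h3 : 0 ≤ ∑ i, ∑ j, |slRealMatrix (kMat A)⁻¹ i j| :=
    Finset.sum_nonneg fun _ _ ↦ Finset.sum_nonneg fun _ _ ↦ abs_nonneg _
  have h4 := abs_nonneg (nCoef A 1)
  have h5 := abs_nonneg (nCoef A 2)
  linarith

/-- `|nCoef 1|, |nCoef 2| ≤ B`. [folklore] -/
theorem abs_nCoef_le : |nCoef A 1| ≤ tsBound A ∧ |nCoef A 2| ≤ tsBound A := by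
  unfold tsBound
  have h1 : 0 ≤ ∑ m, |wordCoef A m| := Finset.sum_nonneg fun _ _ ↦ abs_nonneg _
  have h2 : 0 ≤ ∑ i, ∑ j, |slRealMatrix (kMat A) i j| :=
    Finset.sum_nonneg fun _ _ ↦ Finset.sum_nonneg fun _ _ ↦ abs_nonneg _
  have h3 : 0 ≤ ∑ i, ∑ j, |slRealMatrix (kMat A)⁻¹ i j| :=
    Finset.sum_nonneg fun _ _ ↦ Finset.sum_nonneg fun _ _ ↦ abs_nonneg _
  have h4 := abs_nonneg (nCoef A 1)
  have h5 := abs_nonneg (nCoef A 2)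
  exact ⟨by linarith, by linarith⟩

/-- A double sum of nonnegative terms dominates each term. [folklore] -/
theorem single_le_sum_sum {M : Matrix (Fin 3) (Fin 3) ℝ} (i j : Fin 3) : |M i j| ≤ ∑ i, ∑ j, |M i j| :=
  (Finset.single_le_sum (f := fun j ↦ |M i j|) (fun _ _ ↦ abs_nonneg _) (Finset.mem_univ j)).trans
    (Finset.single_le_sum (f := fun i ↦ ∑ j, |M i j|) (fun _ _ ↦ Finset.sum_nonneg fun _ _ ↦ abs_nonneg _)
      (Finset.mem_univ i))

/-- `|K i j| ≤ B`. [folklore] -/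
theorem abs_kMat_le (i j : Fin 3) : |slRealMatrix (kMat A) i j| ≤ tsBound A := by
  have h := single_le_sum_sum (M := slRealMatrix (kMat A)) i j
  unfold tsBound
  have h1 : 0 ≤ ∑ m, |wordCoef A m| := Finset.sum_nonneg fun _ _ ↦ abs_nonneg _
  have h3 : 0 ≤ ∑ i, ∑ j, |slRealMatrix (kMat A)⁻¹ i j| :=
    Finset.sum_nonneg fun _ _ ↦ Finset.sum_nonneg fun _ _ ↦ abs_nonneg _
  have h4 := abs_nonneg (nCoef A 1)
  have h5 := abs_nonneg (nCoef A 2)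
  linarith

/-- `|K⁻¹ i j| ≤ B`. [folklore] -/
theorem abs_kMat_inv_le (i j : Fin 3) : |slRealMatrix (kMat A)⁻¹ i j| ≤ tsBound A := by
  have h := single_le_sum_sum (M := slRealMatrix (kMat A)⁻¹) i j
  unfold tsBound
  have h1 : 0 ≤ ∑ m, |wordCoef A m| := Finset.sum_nonneg fun _ _ ↦ abs_nonneg _
  have h2 : 0 ≤ ∑ i, ∑ j, |slRealMatrix (kMat A) i j| :=
    Finset.sum_nonneg fun _ _ ↦ Finset.sum_nonneg fun _ _ ↦ abs_nonneg _
  have h4 := abs_nonneg (nCoef A 1)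
  have h5 := abs_nonneg (nCoef A 2)
  linarith

variable {A}

/-- `|μ t · a| ≤ B` when `|a| ≤ B`. [folklore] -/
theorem abs_mu_mul_le {a B : ℝ} (ha : |a| ≤ B) (t : ℝ) : |μT t * a| ≤ B := by
  rw [abs_mul]
  exact (mul_le_of_le_one_left (abs_nonneg a) (abs_μT_le t)).trans ha

/-- Entries of `eMat s`, `|s| ≤ 1`, are bounded by any `B ≥ 2`. [folklore] -/
theorem abs_eMat_le {s B : ℝ} (hs : |s| ≤ 1) (hB : 2 ≤ B) (i j : Fin 3) : |eMat s i j| ≤ B := by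
  have h := abs_le.1 hs
  have h1 : |1 + s| ≤ B := abs_le.2 ⟨by linarith, by linarith⟩
  have h2 : |s| ≤ B := hs.trans (by linarith)
  have h4 : |1 - s| ≤ B := abs_le.2 ⟨by linarith, by linarith⟩
  have h5 : (1 : ℝ) ≤ B := by linarith
  have h6 : (0 : ℝ) ≤ B := by linarith
  fin_cases i <;> fin_cases j <;> simp [eMat, h1, h2, h4, h5, h6]

/-- Entries of `uMat s`, `|s| ≤ B`, `1 ≤ B`. [folklore] -/
theorem abs_uMat_le {s B : ℝ} (hs : |s| ≤ B) (hB : 1 ≤ B) (i j : Fin 3) : |uMat s i j| ≤ B := by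
  fin_cases i <;> fin_cases j <;> simp [uMat, hs] <;> linarith

/-- Entries of `loMat s`, `|s| ≤ B`, `1 ≤ B`. [folklore] -/
theorem abs_loMat_le {s B : ℝ} (hs : |s| ≤ B) (hB : 1 ≤ B) (i j : Fin 3) : |loMat s i j| ≤ B := by
  fin_cases i <;> fin_cases j <;> simp [loMat, hs] <;> linarith

/-- Entries of `nMat a b`, `|a|, |b| ≤ B`, `1 ≤ B`. [folklore] -/
theorem abs_nMat_le {a b B : ℝ} (ha : |a| ≤ B) (hb : |b| ≤ B) (hB : 1 ≤ B) (i j : Fin 3) :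
    |nMat a b i j| ≤ B := by
  fin_cases i <;> fin_cases j <;> simp [nMat, ha, hb] <;> linarith

/-- **One step of the chain**: entries `≤ B` and coordinates `< ρ` give coordinates `< 3 B ρ`. [folklore] -/
theorem step_bound {M : Matrix (Fin 3) (Fin 3) ℝ} {B ρ : ℝ} (hB : 1 ≤ B) (hM : ∀ i j, |M i j| ≤ B)
    {v : 𝔼 3} (hv : ∀ j, |v j| < ρ) : ∀ j, |mulVecE M v j| < 3 * B * ρ :=
  fun j ↦ abs_mulVecE_lt_of_abs_lt (by linarith) hM hv j

/-- Monotonicity of the chain radii: `ρ ≤ 3 B ρ` for `ρ ≥ 0`, `B ≥ 1`. [folklore] -/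
theorem le_three_mul_mul {B ρ : ℝ} (hB : 1 ≤ B) (hρ : 0 ≤ ρ) : ρ ≤ 3 * B * ρ := by nlinarith

end Bounds

/-! ### The straightening -/

section Construction

variable (A : Matrix.SpecialLinearGroup (Fin 3) ℤ)

/-- **The shear word `σ_t`** (time-one map `K⁻¹` on the tube): `n`-shear first, then
`U(a₃) ∘ L(b₂) ∘ U(a₂) ∘ L(b₁) ∘ U(a₁)` applied in this order. [folklore] -/
def sigmaD : Diffeotopy 𝓣 ThreeTorus :=
  (((((nDiffeotopy (nCoef A 1) (nCoef A 2)).trans (uDiffeotopy (wordCoef A 4))).trans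
    (loDiffeotopy (wordCoef A 3))).trans (uDiffeotopy (wordCoef A 2))).trans
      (loDiffeotopy (wordCoef A 1))).trans (uDiffeotopy (wordCoef A 0))

/-- **The based diffeotopy `D_t = (K⁻¹ ∘ E_t ∘ K) ∘ σ_t`.** [cite: GompfAGT2010, §4 Def. 4.1 (straightened monodromies)] -/
def tsD : Diffeotopy 𝓣 ThreeTorus :=
  (sigmaD A).trans (eDiffeotopy.conj (torusDiffeomorph (kMat A)))

/-- The linear parts `G_t`. [folklore] -/
def tsG (t : ℝ) : Matrix (Fin 3) (Fin 3) ℝ :=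
  slRealMatrix (kMat A)⁻¹ * eMat (μT t) * slRealMatrix (kMat A) * uMat (μT t * wordCoef A 0) *
    loMat (μT t * wordCoef A 1) * uMat (μT t * wordCoef A 2) * loMat (μT t * wordCoef A 3) *
      uMat (μT t * wordCoef A 4) * nMat (μT t * nCoef A 1) (μT t * nCoef A 2)

/-- The inverse linear parts `G_t⁻¹`. [folklore] -/
def tsGinv (t : ℝ) : Matrix (Fin 3) (Fin 3) ℝ :=
  nMat (-(μT t * nCoef A 1)) (-(μT t * nCoef A 2)) * uMat (-(μT t * wordCoef A 4)) *
    loMat (-(μT t * wordCoef A 3)) * uMat (-(μT t * wordCoef A 2)) * loMat (-(μT t * wordCoef A 1)) *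
      uMat (-(μT t * wordCoef A 0)) * slRealMatrix (kMat A)⁻¹ * eMat (-μT t) * slRealMatrix (kMat A)

/-- The cube radius `R = 1 / (2 (3B)^8)`. [folklore] -/
def tsRad : ℝ := 1 / (2 * (3 * tsBound A) ^ 8)

/-- `0 < R`. [folklore] -/
theorem tsRad_pos : 0 < tsRad A := by
  unfold tsRad; have := tsBound_pos A; positivity

/-- `(3B)^k R ≤ 1/2` for `k ≤ 8`. [folklore] -/
theorem pow_mul_tsRad_le {k : ℕ} (hk : k ≤ 8) : (3 * tsBound A) ^ k * tsRad A ≤ 1 / 2 := by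
  have hB : 1 ≤ 3 * tsBound A := by linarith [one_le_tsBound A]
  have hpow : (3 * tsBound A) ^ k ≤ (3 * tsBound A) ^ 8 := pow_le_pow_right₀ hB hk
  have h8 : 0 < (3 * tsBound A) ^ 8 := by positivity
  unfold tsRad
  rw [show (3 * tsBound A) ^ k * (1 / (2 * (3 * tsBound A) ^ 8)) =
    (3 * tsBound A) ^ k / (3 * tsBound A) ^ 8 / 2 by field_simp]
  have : (3 * tsBound A) ^ k / (3 * tsBound A) ^ 8 ≤ 1 := (div_le_one h8).2 hpow
  linarith

/-- **Telescoping**: `P₁ ⋯ P₉ · (Q₉ ⋯ Q₁) = 1` when `Pᵢ Qᵢ = 1` (abstract, to keep the kernel away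
from concrete matrix entries). [folklore] -/
theorem prod_nine_mul_rev {R : Type*} [Monoid R] {P₁ P₂ P₃ P₄ P₅ P₆ P₇ P₈ P₉ Q₁ Q₂ Q₃ Q₄ Q₅ Q₆ Q₇ Q₈ Q₉ : R}
    (h₁ : P₁ * Q₁ = 1) (h₂ : P₂ * Q₂ = 1) (h₃ : P₃ * Q₃ = 1) (h₄ : P₄ * Q₄ = 1) (h₅ : P₅ * Q₅ = 1)
    (h₆ : P₆ * Q₆ = 1) (h₇ : P₇ * Q₇ = 1) (h₈ : P₈ * Q₈ = 1) (h₉ : P₉ * Q₉ = 1) :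
    P₁ * P₂ * P₃ * P₄ * P₅ * P₆ * P₇ * P₈ * P₉ * (Q₉ * Q₈ * Q₇ * Q₆ * Q₅ * Q₄ * Q₃ * Q₂ * Q₁) = 1 := by
  have c : ∀ {X Y : R} (Z : R), X * Y = 1 → X * (Y * Z) = Z := fun Z h ↦ by rw [← mul_assoc, h, one_mul]
  simp only [mul_assoc]
  rw [c _ h₉, c _ h₈, c _ h₇, c _ h₆, c _ h₅, c _ h₄, c _ h₃, c _ h₂, h₁]

/-- `G_t G_t⁻¹ = 1`. [folklore] -/
theorem tsG_mul_tsGinv (t : ℝ) : tsG A t * tsGinv A t = 1 :=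
  prod_nine_mul_rev (slRealMatrix_inv_mul (kMat A)) (eMat_mul_neg _) (slRealMatrix_mul_inv (kMat A))
    (uMat_mul_neg _) (loMat_mul_neg _) (uMat_mul_neg _) (loMat_mul_neg _) (uMat_mul_neg _) (nMat_mul_neg _ _)

/-- `G_t⁻¹ G_t = 1`. [folklore] -/
theorem tsGinv_mul_tsG (t : ℝ) : tsGinv A t * tsG A t = 1 := by
  have e1 : eMat (-μT t) * eMat (μT t) = 1 := by simpa using eMat_mul_neg (-μT t)
  have u1 : ∀ s : ℝ, uMat (-s) * uMat s = 1 := fun s ↦ by simpa using uMat_mul_neg (-s)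
  have l1 : ∀ s : ℝ, loMat (-s) * loMat s = 1 := fun s ↦ by simpa using loMat_mul_neg (-s)
  have n1 : ∀ a b : ℝ, nMat (-a) (-b) * nMat a b = 1 := fun a b ↦ by simpa using nMat_mul_neg (-a) (-b)
  exact prod_nine_mul_rev (n1 _ _) (u1 _) (l1 _) (u1 _) (l1 _) (u1 _) (slRealMatrix_inv_mul (kMat A)) e1
    (slRealMatrix_mul_inv (kMat A))

/-- Entries of `G_t` are smooth in `t`. [folklore] -/
theorem contDiff_tsG (i j : Fin 3) : ContDiff ℝ ∞ fun t ↦ tsG A t i j := by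
  have hμ : ContDiff ℝ ∞ μT := Real.smoothTransition.contDiff
  have hc : ∀ (M : Matrix (Fin 3) (Fin 3) ℝ) (i j : Fin 3), ContDiff ℝ ∞ fun _ : ℝ ↦ M i j :=
    fun M i j ↦ contDiff_const
  have h1 : ∀ i j, ContDiff ℝ ∞ fun t ↦ (slRealMatrix (kMat A)⁻¹ * eMat (μT t)) i j :=
    SmoothMatrixPath.contDiff_mul_apply (hc _) (contDiff_eMat_apply hμ)
  have h2 : ∀ i j, ContDiff ℝ ∞ fun t ↦ (slRealMatrix (kMat A)⁻¹ * eMat (μT t) * slRealMatrix (kMat A)) i j :=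
    SmoothMatrixPath.contDiff_mul_apply h1 (hc _)
  have h3 : ∀ i j, ContDiff ℝ ∞ fun t ↦ (slRealMatrix (kMat A)⁻¹ * eMat (μT t) * slRealMatrix (kMat A) *
      uMat (μT t * wordCoef A 0)) i j :=
    SmoothMatrixPath.contDiff_mul_apply h2 (contDiff_uMat_apply (hμ.mul contDiff_const))
  have h4 : ∀ i j, ContDiff ℝ ∞ fun t ↦ (slRealMatrix (kMat A)⁻¹ * eMat (μT t) * slRealMatrix (kMat A) *
      uMat (μT t * wordCoef A 0) * loMat (μT t * wordCoef A 1)) i j :=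
    SmoothMatrixPath.contDiff_mul_apply h3 (contDiff_loMat_apply (hμ.mul contDiff_const))
  have h5 : ∀ i j, ContDiff ℝ ∞ fun t ↦ (slRealMatrix (kMat A)⁻¹ * eMat (μT t) * slRealMatrix (kMat A) *
      uMat (μT t * wordCoef A 0) * loMat (μT t * wordCoef A 1) * uMat (μT t * wordCoef A 2)) i j :=
    SmoothMatrixPath.contDiff_mul_apply h4 (contDiff_uMat_apply (hμ.mul contDiff_const))
  have h6 : ∀ i j, ContDiff ℝ ∞ fun t ↦ (slRealMatrix (kMat A)⁻¹ * eMat (μT t) * slRealMatrix (kMat A) *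
      uMat (μT t * wordCoef A 0) * loMat (μT t * wordCoef A 1) * uMat (μT t * wordCoef A 2) *
      loMat (μT t * wordCoef A 3)) i j :=
    SmoothMatrixPath.contDiff_mul_apply h5 (contDiff_loMat_apply (hμ.mul contDiff_const))
  have h7 : ∀ i j, ContDiff ℝ ∞ fun t ↦ (slRealMatrix (kMat A)⁻¹ * eMat (μT t) * slRealMatrix (kMat A) *
      uMat (μT t * wordCoef A 0) * loMat (μT t * wordCoef A 1) * uMat (μT t * wordCoef A 2) *
      loMat (μT t * wordCoef A 3) * uMat (μT t * wordCoef A 4)) i j :=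
    SmoothMatrixPath.contDiff_mul_apply h6 (contDiff_uMat_apply (hμ.mul contDiff_const))
  exact SmoothMatrixPath.contDiff_mul_apply h7
    (contDiff_nMat_apply (hμ.mul contDiff_const) (hμ.mul contDiff_const)) i j

/-- Entries of `G_t⁻¹` are smooth in `t`. [folklore] -/
theorem contDiff_tsGinv (i j : Fin 3) : ContDiff ℝ ∞ fun t ↦ tsGinv A t i j := by
  have hμ : ContDiff ℝ ∞ μT := Real.smoothTransition.contDiff
  have hn : ∀ a : ℝ, ContDiff ℝ ∞ fun t ↦ -(μT t * a) := fun a ↦ (hμ.mul contDiff_const).neg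
  have hc : ∀ (M : Matrix (Fin 3) (Fin 3) ℝ) (i j : Fin 3), ContDiff ℝ ∞ fun _ : ℝ ↦ M i j :=
    fun M i j ↦ contDiff_const
  have h1 : ∀ i j, ContDiff ℝ ∞ fun t ↦ (nMat (-(μT t * nCoef A 1)) (-(μT t * nCoef A 2)) *
      uMat (-(μT t * wordCoef A 4))) i j :=
    SmoothMatrixPath.contDiff_mul_apply (contDiff_nMat_apply (hn _) (hn _)) (contDiff_uMat_apply (hn _))
  have h2 : ∀ i j, ContDiff ℝ ∞ fun t ↦ (nMat (-(μT t * nCoef A 1)) (-(μT t * nCoef A 2)) *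
      uMat (-(μT t * wordCoef A 4)) * loMat (-(μT t * wordCoef A 3))) i j :=
    SmoothMatrixPath.contDiff_mul_apply h1 (contDiff_loMat_apply (hn _))
  have h3 : ∀ i j, ContDiff ℝ ∞ fun t ↦ (nMat (-(μT t * nCoef A 1)) (-(μT t * nCoef A 2)) *
      uMat (-(μT t * wordCoef A 4)) * loMat (-(μT t * wordCoef A 3)) * uMat (-(μT t * wordCoef A 2))) i j :=
    SmoothMatrixPath.contDiff_mul_apply h2 (contDiff_uMat_apply (hn _))
  have h4 : ∀ i j, ContDiff ℝ ∞ fun t ↦ (nMat (-(μT t * nCoef A 1)) (-(μT t * nCoef A 2)) *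
      uMat (-(μT t * wordCoef A 4)) * loMat (-(μT t * wordCoef A 3)) * uMat (-(μT t * wordCoef A 2)) *
      loMat (-(μT t * wordCoef A 1))) i j :=
    SmoothMatrixPath.contDiff_mul_apply h3 (contDiff_loMat_apply (hn _))
  have h5 : ∀ i j, ContDiff ℝ ∞ fun t ↦ (nMat (-(μT t * nCoef A 1)) (-(μT t * nCoef A 2)) *
      uMat (-(μT t * wordCoef A 4)) * loMat (-(μT t * wordCoef A 3)) * uMat (-(μT t * wordCoef A 2)) *
      loMat (-(μT t * wordCoef A 1)) * uMat (-(μT t * wordCoef A 0))) i j :=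
    SmoothMatrixPath.contDiff_mul_apply h4 (contDiff_uMat_apply (hn _))
  have h6 : ∀ i j, ContDiff ℝ ∞ fun t ↦ (nMat (-(μT t * nCoef A 1)) (-(μT t * nCoef A 2)) *
      uMat (-(μT t * wordCoef A 4)) * loMat (-(μT t * wordCoef A 3)) * uMat (-(μT t * wordCoef A 2)) *
      loMat (-(μT t * wordCoef A 1)) * uMat (-(μT t * wordCoef A 0)) * slRealMatrix (kMat A)⁻¹) i j :=
    SmoothMatrixPath.contDiff_mul_apply h5 (hc _)
  have h7 : ∀ i j, ContDiff ℝ ∞ fun t ↦ (nMat (-(μT t * nCoef A 1)) (-(μT t * nCoef A 2)) *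
      uMat (-(μT t * wordCoef A 4)) * loMat (-(μT t * wordCoef A 3)) * uMat (-(μT t * wordCoef A 2)) *
      loMat (-(μT t * wordCoef A 1)) * uMat (-(μT t * wordCoef A 0)) * slRealMatrix (kMat A)⁻¹ *
      eMat (-μT t)) i j :=
    SmoothMatrixPath.contDiff_mul_apply h6 (contDiff_eMat_apply hμ.neg)
  exact SmoothMatrixPath.contDiff_mul_apply h7 (hc _) i j

/-- `G_0 = 1`. [folklore] -/
theorem tsG_zero : tsG A 0 = 1 := by
  unfold tsG
  simp only [μT, Real.smoothTransition.zero, zero_mul, eMat_zero, uMat_zero, loMat_zero, nMat_zero,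
    Matrix.mul_one]
  exact slRealMatrix_inv_mul _

variable {A}

/-- **`G_1 = A⁻¹`** (`K⁻¹ L K · K⁻¹ = K⁻¹ L = A⁻¹`). [cite: GompfAGT2010, §4 Def. 4.1] -/
theorem tsG_one (hA : IsGompfStandardForm A) : tsG A 1 = slRealMatrix A⁻¹ := by
  have h : tsG A 1 = slRealMatrix (kMat A)⁻¹ * eMat 1 * slRealMatrix (kMat A) *
      (kWord A * nMat (nCoef A 1) (nCoef A 2)) := by
    unfold tsG kWord blockWord
    simp only [μT, Real.smoothTransition.one, one_mul, Matrix.mul_assoc]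
  rw [h, kWord_mul_nMat hA, ← slRealMatrix_lMat, ← slRealMatrix_mul, ← slRealMatrix_mul,
    ← slRealMatrix_mul, mul_assoc, mul_inv_cancel, mul_one, kMat_inv_mul_lMat]

/-- Inverse stages of a conjugated diffeotopy. [folklore] -/
theorem conj_invFun' (D : Diffeotopy 𝓣 ThreeTorus) (h : ThreeTorus ≃ₘ⟮𝓣, 𝓣⟯ ThreeTorus) (t : ℝ)
    (y : ThreeTorus) : (D.conj h).invFun t y = h.symm (D.invFun t (h y)) := by
  apply (D.conj h).toFun_injective t
  rw [(D.conj h).toFun_invFun, Diffeotopy.conj_toFun, Diffeomorph.apply_symm_apply, D.toFun_invFun,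
    Diffeomorph.symm_apply_apply]

/-- `B⁻¹ 1 = 1` on `T³`. [folklore] -/
theorem torusDiffeomorph_symm_apply_one (B : Matrix.SpecialLinearGroup (Fin 3) ℤ) :
    (torusDiffeomorph B).symm 1 = 1 := by
  conv_lhs => rw [← torusDiffeomorph_apply_one B]
  exact Diffeomorph.symm_apply_apply _ _

/-- Every stage of a shift diffeotopy with amount vanishing at `1` fixes `1`. [folklore] -/
theorem triShift_one_of_eq_zero (a b c : ℝ) {θ : ℝ} (h : θ = 0) : triShift a b c θ 1 = 1 := by
  rw [h, triShift_zero]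

variable (A)

/-- **All stages of `D_t` fix the base point.** [folklore] -/
theorem tsD_based (t : ℝ) : (tsD A).toFun t 1 = 1 := by
  have h1 : ∀ k, (uDiffeotopy k).toFun t 1 = 1 := fun k ↦
    triShift_one_of_eq_zero _ _ _ (by simp)
  have h2 : ∀ k, (loDiffeotopy k).toFun t 1 = 1 := fun k ↦
    triShift_one_of_eq_zero _ _ _ (by simp)
  have h3 : ∀ a b, (nDiffeotopy a b).toFun t 1 = 1 := fun a b ↦
    triShift_one_of_eq_zero _ _ _ (by simp)
  have h4 : eDiffeotopy.toFun t 1 = 1 := triShift_one_of_eq_zero _ _ _ (by simp)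
  simp only [tsD, sigmaD, Diffeotopy.trans_toFun, comp_apply, h1, h2, h3, Diffeotopy.conj_toFun,
    torusDiffeomorph_apply_one, h4, torusDiffeomorph_symm_apply_one]

/-- **Exact linearity of the stages on the cube `|vᵢ| < R`.** [cite: GompfAGT2010, §4 Def. 4.1 (exactly linear germs)] -/
theorem tsD_toFun_expT (t : ℝ) (v : 𝔼 3) (hv : ∀ i, |v i| < tsRad A) :
    (tsD A).toFun t (expT v) = expT (mulVecE (tsG A t) v) := by
  have hB := one_le_tsBound A
  have hB2 := two_le_tsBound A
  set B := tsBound A with hBdef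
  have hR : ∀ {k : ℕ}, k ≤ 8 → (3 * B) ^ k * tsRad A ≤ 1 / 2 := fun hk ↦ pow_mul_tsRad_le A hk
  -- the chain of vectors
  set v1 := mulVecE (nMat (μT t * nCoef A 1) (μT t * nCoef A 2)) v with hv1
  set v2 := mulVecE (uMat (μT t * wordCoef A 4)) v1 with hv2
  set v3 := mulVecE (loMat (μT t * wordCoef A 3)) v2 with hv3
  set v4 := mulVecE (uMat (μT t * wordCoef A 2)) v3 with hv4
  set v5 := mulVecE (loMat (μT t * wordCoef A 1)) v4 with hv5
  set v6 := mulVecE (uMat (μT t * wordCoef A 0)) v5 with hv6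
  set v7 := mulVecE (slRealMatrix (kMat A)) v6 with hv7
  set v8 := mulVecE (eMat (μT t)) v7 with hv8
  have b0 : ∀ j, |v j| < (3 * B) ^ 0 * tsRad A := fun j ↦ by simpa using hv j
  have b1 : ∀ j, |v1 j| < (3 * B) ^ 1 * tsRad A := by
    have := step_bound hB (abs_nMat_le (abs_mu_mul_le (abs_nCoef_le A).1 t)
      (abs_mu_mul_le (abs_nCoef_le A).2 t) hB) b0
    simpa [pow_succ, mul_assoc, mul_comm, mul_left_comm] using this
  have b2 : ∀ j, |v2 j| < (3 * B) ^ 2 * tsRad A := by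
    have := step_bound hB (abs_uMat_le (abs_mu_mul_le (abs_wordCoef_le A 4) t) hB) b1
    simpa [pow_succ, mul_assoc, mul_comm, mul_left_comm] using this
  have b3 : ∀ j, |v3 j| < (3 * B) ^ 3 * tsRad A := by
    have := step_bound hB (abs_loMat_le (abs_mu_mul_le (abs_wordCoef_le A 3) t) hB) b2
    simpa [pow_succ, mul_assoc, mul_comm, mul_left_comm] using this
  have b4 : ∀ j, |v4 j| < (3 * B) ^ 4 * tsRad A := by
    have := step_bound hB (abs_uMat_le (abs_mu_mul_le (abs_wordCoef_le A 2) t) hB) b3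
    simpa [pow_succ, mul_assoc, mul_comm, mul_left_comm] using this
  have b5 : ∀ j, |v5 j| < (3 * B) ^ 5 * tsRad A := by
    have := step_bound hB (abs_loMat_le (abs_mu_mul_le (abs_wordCoef_le A 1) t) hB) b4
    simpa [pow_succ, mul_assoc, mul_comm, mul_left_comm] using this
  have b6 : ∀ j, |v6 j| < (3 * B) ^ 6 * tsRad A := by
    have := step_bound hB (abs_uMat_le (abs_mu_mul_le (abs_wordCoef_le A 0) t) hB) b5
    simpa [pow_succ, mul_assoc, mul_comm, mul_left_comm] using this
  have b7 : ∀ j, |v7 j| < (3 * B) ^ 7 * tsRad A := by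
    have := step_bound hB (abs_kMat_le A) b6
    simpa [pow_succ, mul_assoc, mul_comm, mul_left_comm] using this
  have lt1 : ∀ {k : ℕ} (hk : k ≤ 8) {w : 𝔼 3}, (∀ j, |w j| < (3 * B) ^ k * tsRad A) → ∀ j, |w j| < 1 := by
    intro k hk w hw j
    exact (hw j).trans_le ((hR hk).trans (by norm_num))
  have lt2 : ∀ {k : ℕ} (hk : k ≤ 8) {w : 𝔼 3}, (∀ j, |w j| < (3 * B) ^ k * tsRad A) → ∀ j, |w j| < 1 / 2 := by
    intro k hk w hw j
    exact (hw j).trans_le (hR hk)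
  -- unfold the stage
  have hstage : (tsD A).toFun t (expT v) = (torusDiffeomorph (kMat A)).symm (eDiffeotopy.toFun t
      (torusDiffeomorph (kMat A) ((uDiffeotopy (wordCoef A 0)).toFun t ((loDiffeotopy (wordCoef A 1)).toFun t
        ((uDiffeotopy (wordCoef A 2)).toFun t ((loDiffeotopy (wordCoef A 3)).toFun t
          ((uDiffeotopy (wordCoef A 4)).toFun t ((nDiffeotopy (nCoef A 1) (nCoef A 2)).toFun t (expT v))))))))) := by
    simp only [tsD, sigmaD, Diffeotopy.trans_toFun, comp_apply, Diffeotopy.conj_toFun]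
  rw [hstage, nDiffeotopy_toFun_expT _ _ t (lt1 (by norm_num) b0 1) (lt1 (by norm_num) b0 2), ← hv1,
    uDiffeotopy_toFun_expT _ t (lt1 (by norm_num) b1 2), ← hv2,
    loDiffeotopy_toFun_expT _ t (lt1 (by norm_num) b2 1), ← hv3,
    uDiffeotopy_toFun_expT _ t (lt1 (by norm_num) b3 2), ← hv4,
    loDiffeotopy_toFun_expT _ t (lt1 (by norm_num) b4 1), ← hv5,
    uDiffeotopy_toFun_expT _ t (lt1 (by norm_num) b5 2), ← hv6,
    torusDiffeomorph_expT, ← hv7,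
    eDiffeotopy_toFun_expT t (lt2 (by norm_num) b7 0) (lt2 (by norm_num) b7 2), ← hv8,
    torusDiffeomorph_symm_expT]
  congr 1
  simp only [hv8, hv7, hv6, hv5, hv4, hv3, hv2, hv1, mulVecE_mulVecE, tsG, Matrix.mul_assoc]

/-- **Exact linearity of the inverse stages on the cube `|vᵢ| < R`.** [folklore] -/
theorem tsD_invFun_expT (t : ℝ) (v : 𝔼 3) (hv : ∀ i, |v i| < tsRad A) :
    (tsD A).invFun t (expT v) = expT (mulVecE (tsGinv A t) v) := by
  have hB := one_le_tsBound A
  have hB2 := two_le_tsBound A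
  set B := tsBound A with hBdef
  have hR : ∀ {k : ℕ}, k ≤ 8 → (3 * B) ^ k * tsRad A ≤ 1 / 2 := fun hk ↦ pow_mul_tsRad_le A hk
  set v1 := mulVecE (slRealMatrix (kMat A)) v with hv1
  set v2 := mulVecE (eMat (-μT t)) v1 with hv2
  set v3 := mulVecE (slRealMatrix (kMat A)⁻¹) v2 with hv3
  set v4 := mulVecE (uMat (-(μT t * wordCoef A 0))) v3 with hv4
  set v5 := mulVecE (loMat (-(μT t * wordCoef A 1))) v4 with hv5
  set v6 := mulVecE (uMat (-(μT t * wordCoef A 2))) v5 with hv6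
  set v7 := mulVecE (loMat (-(μT t * wordCoef A 3))) v6 with hv7
  set v8 := mulVecE (uMat (-(μT t * wordCoef A 4))) v7 with hv8
  have habsneg : ∀ {a : ℝ}, |a| ≤ B → |(-(μT t * a))| ≤ B := fun ha ↦ by
    rw [abs_neg]; exact abs_mu_mul_le ha t
  have b0 : ∀ j, |v j| < (3 * B) ^ 0 * tsRad A := fun j ↦ by simpa using hv j
  have b1 : ∀ j, |v1 j| < (3 * B) ^ 1 * tsRad A := by
    have := step_bound hB (abs_kMat_le A) b0
    simpa [pow_succ, mul_assoc, mul_comm, mul_left_comm] using this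
  have b2 : ∀ j, |v2 j| < (3 * B) ^ 2 * tsRad A := by
    have := step_bound hB (abs_eMat_le (by rw [abs_neg]; exact abs_μT_le t) hB2) b1
    simpa [pow_succ, mul_assoc, mul_comm, mul_left_comm] using this
  have b3 : ∀ j, |v3 j| < (3 * B) ^ 3 * tsRad A := by
    have := step_bound hB (abs_kMat_inv_le A) b2
    simpa [pow_succ, mul_assoc, mul_comm, mul_left_comm] using this
  have b4 : ∀ j, |v4 j| < (3 * B) ^ 4 * tsRad A := by
    have := step_bound hB (abs_uMat_le (habsneg (abs_wordCoef_le A 0)) hB) b3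
    simpa [pow_succ, mul_assoc, mul_comm, mul_left_comm] using this
  have b5 : ∀ j, |v5 j| < (3 * B) ^ 5 * tsRad A := by
    have := step_bound hB (abs_loMat_le (habsneg (abs_wordCoef_le A 1)) hB) b4
    simpa [pow_succ, mul_assoc, mul_comm, mul_left_comm] using this
  have b6 : ∀ j, |v6 j| < (3 * B) ^ 6 * tsRad A := by
    have := step_bound hB (abs_uMat_le (habsneg (abs_wordCoef_le A 2)) hB) b5
    simpa [pow_succ, mul_assoc, mul_comm, mul_left_comm] using this
  have b7 : ∀ j, |v7 j| < (3 * B) ^ 7 * tsRad A := by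
    have := step_bound hB (abs_loMat_le (habsneg (abs_wordCoef_le A 3)) hB) b6
    simpa [pow_succ, mul_assoc, mul_comm, mul_left_comm] using this
  have b8 : ∀ j, |v8 j| < (3 * B) ^ 8 * tsRad A := by
    have := step_bound hB (abs_uMat_le (habsneg (abs_wordCoef_le A 4)) hB) b7
    simpa [pow_succ, mul_assoc, mul_comm, mul_left_comm] using this
  have lt1 : ∀ {k : ℕ} (hk : k ≤ 8) {w : 𝔼 3}, (∀ j, |w j| < (3 * B) ^ k * tsRad A) → ∀ j, |w j| < 1 := by
    intro k hk w hw j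
    exact (hw j).trans_le ((hR hk).trans (by norm_num))
  have lt2 : ∀ {k : ℕ} (hk : k ≤ 8) {w : 𝔼 3}, (∀ j, |w j| < (3 * B) ^ k * tsRad A) → ∀ j, |w j| < 1 / 2 := by
    intro k hk w hw j
    exact (hw j).trans_le (hR hk)
  have hstage : (tsD A).invFun t (expT v) =
      (nDiffeotopy (nCoef A 1) (nCoef A 2)).invFun t ((uDiffeotopy (wordCoef A 4)).invFun t
        ((loDiffeotopy (wordCoef A 3)).invFun t ((uDiffeotopy (wordCoef A 2)).invFun t
          ((loDiffeotopy (wordCoef A 1)).invFun t ((uDiffeotopy (wordCoef A 0)).invFun t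
            ((torusDiffeomorph (kMat A)).symm (eDiffeotopy.invFun t (torusDiffeomorph (kMat A) (expT v))))))))) := by
    simp only [tsD, sigmaD, Diffeotopy.trans_invFun, comp_apply, conj_invFun']
  rw [hstage, torusDiffeomorph_expT, ← hv1,
    eDiffeotopy_invFun_expT t (lt2 (by norm_num) b1 0) (lt2 (by norm_num) b1 2), ← hv2,
    torusDiffeomorph_symm_expT, ← hv3,
    uDiffeotopy_invFun_expT _ t (lt1 (by norm_num) b3 2), ← hv4,
    loDiffeotopy_invFun_expT _ t (lt1 (by norm_num) b4 1), ← hv5,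
    uDiffeotopy_invFun_expT _ t (lt1 (by norm_num) b5 2), ← hv6,
    loDiffeotopy_invFun_expT _ t (lt1 (by norm_num) b6 1), ← hv7,
    uDiffeotopy_invFun_expT _ t (lt1 (by norm_num) b7 2), ← hv8,
    nDiffeotopy_invFun_expT _ _ t (lt1 (by norm_num) b8 1) (lt1 (by norm_num) b8 2)]
  congr 1
  simp only [hv8, hv7, hv6, hv5, hv4, hv3, hv2, hv1, mulVecE_mulVecE, tsGinv, Matrix.mul_assoc]

/-- **The tube straightening of a standard-form `A`**: a straightening of `A` with exactly linear
germs whose monodromy is an explicit shear on a tube about `α` (`tubeStraightening_monodromy_apply`). [cite: GompfAGT2010, §2 ¶1 and §4 Def. 4.1] -/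
def tubeStraightening (hA : IsGompfStandardForm A) : Straightening A where
  D := tsD A
  based := tsD_based A
  G := tsG A
  Ginv := tsGinv A
  contDiff_G := contDiff_tsG A
  contDiff_Ginv := contDiff_tsGinv A
  G_mul_Ginv := tsG_mul_tsGinv A
  Ginv_mul_G := tsGinv_mul_tsG A
  G_zero := tsG_zero A
  G_one := tsG_one hA
  R := tsRad A
  R_pos := tsRad_pos A
  toFun_expT := tsD_toFun_expT A
  invFun_expT := tsD_invFun_expT A

end Construction

/-! ### The monodromy on the tube about `α` -/

section Monodromy

/-- **The seam circle map** `F(u) = u · e^{-i saw(u)}`: `1` for `arg u ∉ (1, 2)`, winding once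
along the arc `1 < arg u < 2`; `F(z₁) = z₁ · shearFactor 1 z₁ 1` (`GompfShearModel.lean`). [cite: GompfAGT2010, Thm 2.1 (proof: φ(α) and -α differ by the class of γ)] -/
def shearF (u : Circle) : Circle := u * Circle.exp (-sawArg u)

/-- `F(u) = u · shearFactor 1 u 1`. [folklore] -/
theorem shearF_eq_mul_shearFactor (u : Circle) : shearF u = u * shearFactor 1 u 1 := by
  simp [shearF, shearFactor]

/-- **`F = 1` on the arc `arg u ≤ 1`.** [folklore] -/
theorem shearF_eq_one_of_arg_le_one {u : Circle} (h : arg (u : ℂ) ≤ 1) : shearF u = 1 := by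
  have hu : sawArg u = arg (u : ℂ) := by
    conv_lhs => rw [← Circle.exp_arg u]
    exact sawArg_exp (Complex.neg_pi_lt_arg _) h
  calc shearF u = Circle.exp (arg (u : ℂ)) * Circle.exp (-arg (u : ℂ)) := by rw [shearF, hu, Circle.exp_arg]
    _ = 1 := by rw [← Circle.exp_add, add_neg_cancel, Circle.exp_zero]

/-- **`F = 1` on the arc `2 ≤ arg u`.** [folklore] -/
theorem shearF_eq_one_of_two_le_arg {u : Circle} (h : 2 ≤ arg (u : ℂ)) : shearF u = 1 := by
  have hu : sawArg u = arg (u : ℂ) - 2 * π := by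
    have h1 : sawArg u = arg (u : ℂ) - gompfLift 1 2 (arg (u : ℂ)) := by
      rw [sawArg, gompfLift, Circle.exp_arg]; ring
    rw [h1, gompfLift_eq_two_pi one_pos one_lt_two (by linarith [Real.pi_gt_three]) h
      ((Complex.arg_le_pi _).trans (by linarith [Real.pi_pos]))]
  calc shearF u = Circle.exp (arg (u : ℂ)) * Circle.exp (-(arg (u : ℂ) - 2 * π)) := by
        rw [shearF, hu, Circle.exp_arg]
    _ = 1 := by rw [← Circle.exp_add, show arg (u : ℂ) + -(arg (u : ℂ) - 2 * π) = 2 * π by ring,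
        Circle.exp_two_pi]

/-- **The tube shear** `(z₁, z₂, z₃) ↦ (z₁ F(z₁z₃)⁻¹, z₂, z₃ F(z₁z₃))`: in the coordinates
`n = x + z`, `ℓ = z` it is `(n, y, ℓ) ↦ (n, y, ℓ + G(n))`, `e^{iG} = F`. [cite: GompfAGT2010, Thm 2.1 (hypotheses: α, φ(α) ⊂ T meeting in an arc)] -/
def tubeShear (z : ThreeTorus) : ThreeTorus :=
  (z.1 * (shearF (z.1 * z.2.2))⁻¹, z.2.1, z.2.2 * shearF (z.1 * z.2.2))

/-- Where `F(z₁ z₃) = 1` the tube shear is the identity. [folklore] -/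
theorem tubeShear_eq_self {z : ThreeTorus} (h : shearF (z.1 * z.2.2) = 1) : tubeShear z = z := by
  simp [tubeShear, h]

variable (A : Matrix.SpecialLinearGroup (Fin 3) ℤ)

/-- **The tube radius** `r = 1 / (2 (2B)^6)` (`≥ R`). [folklore] -/
def tubeRad : ℝ := 1 / (2 * (2 * tsBound A) ^ 6)

/-- `0 < r`. [folklore] -/
theorem tubeRad_pos : 0 < tubeRad A := by
  unfold tubeRad; have := tsBound_pos A; positivity

/-- `(2B)^k r ≤ 1/2` for `k ≤ 6`. [folklore] -/
theorem pow_mul_tubeRad_le {k : ℕ} (hk : k ≤ 6) : (2 * tsBound A) ^ k * tubeRad A ≤ 1 / 2 := by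
  have hB : 1 ≤ 2 * tsBound A := by linarith [one_le_tsBound A]
  have hpow : (2 * tsBound A) ^ k ≤ (2 * tsBound A) ^ 6 := pow_le_pow_right₀ hB hk
  have h6 : 0 < (2 * tsBound A) ^ 6 := by positivity
  unfold tubeRad
  rw [show (2 * tsBound A) ^ k * (1 / (2 * (2 * tsBound A) ^ 6)) =
    (2 * tsBound A) ^ k / (2 * tsBound A) ^ 6 / 2 by field_simp]
  have : (2 * tsBound A) ^ k / (2 * tsBound A) ^ 6 ≤ 1 := (div_le_one h6).2 hpow
  linarith

/-- `r ≤ 1/4`. [folklore] -/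
theorem tubeRad_le_quarter : tubeRad A ≤ 1 / 4 := by
  have h := pow_mul_tubeRad_le A (k := 1) (by norm_num)
  have hB := one_le_tsBound A
  have hr := tubeRad_pos A
  rw [pow_one] at h
  nlinarith

/-- **`R ≤ r`**: the cube of exact linearity (in particular the ball of the product tube,
`Straightening.prodRad ≤ R`) lies in the tube. [folklore] -/
theorem tsRad_le_tubeRad : tsRad A ≤ tubeRad A := by
  have hB := one_le_tsBound A
  unfold tsRad tubeRad
  have h1 : (2 * tsBound A) ^ 6 ≤ (3 * tsBound A) ^ 6 :=
    pow_le_pow_left₀ (by linarith) (by linarith) 6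
  have h2 : (3 * tsBound A) ^ 6 ≤ (3 * tsBound A) ^ 8 := pow_le_pow_right₀ (by linarith) (by norm_num)
  have h3 : 0 < (2 * tsBound A) ^ 6 := by positivity
  exact one_div_le_one_div_of_le (by positivity) (by linarith)

variable {A}

/-- **One step on the tube**: a matrix with first column `e₀` below the top row moves the
coordinates `1, 2` independently of the coordinate `0`. [folklore] -/
theorem step_bound₁₂ {M : Matrix (Fin 3) (Fin 3) ℝ} {B ρ : ℝ} (hB : 1 ≤ B) (hM : ∀ i j, |M i j| ≤ B)
    (h10 : M 1 0 = 0) (h20 : M 2 0 = 0) {v : 𝔼 3} (h1 : |v 1| < ρ) (h2 : |v 2| < ρ) :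
    |mulVecE M v 1| < 2 * B * ρ ∧ |mulVecE M v 2| < 2 * B * ρ := by
  have key : ∀ i, M i 0 = 0 → |mulVecE M v i| < 2 * B * ρ := fun i hi ↦ by
    rw [mulVecE_apply, Fin.sum_univ_three, hi, zero_mul, zero_add]
    have ha := abs_add_le (M i 1 * v 1) (M i 2 * v 2)
    rw [abs_mul, abs_mul] at ha
    have hb1 : |M i 1| * |v 1| ≤ B * |v 1| := mul_le_mul_of_nonneg_right (hM i 1) (abs_nonneg _)
    have hb2 : |M i 2| * |v 2| ≤ B * |v 2| := mul_le_mul_of_nonneg_right (hM i 2) (abs_nonneg _)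
    have hc1 : B * |v 1| < B * ρ := mul_lt_mul_of_pos_left h1 (by linarith)
    have hc2 : B * |v 2| ≤ B * ρ := mul_le_mul_of_nonneg_left h2.le (by linarith)
    linarith
  exact ⟨key 1 h10, key 2 h20⟩

variable (A)

/-- **The time-one shear word is `K⁻¹` on the tube**, for every first coordinate `x`. [folklore] -/
theorem sigmaD_one_expT (hA : IsGompfStandardForm A) {x y ℓ : ℝ} (hy : |y| < tubeRad A) (hℓ : |ℓ| < tubeRad A) :
    (sigmaD A).toFun 1 (expT (vec3 x y ℓ)) = expT (mulVecE (slRealMatrix (kMat A)⁻¹) (vec3 x y ℓ)) := by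
  have hB := one_le_tsBound A
  set B := tsBound A with hBdef
  have hR : ∀ {k : ℕ}, k ≤ 6 → (2 * B) ^ k * tubeRad A ≤ 1 / 2 := fun hk ↦ pow_mul_tubeRad_le A hk
  have hμ1 : μT 1 = 1 := Real.smoothTransition.one
  set v : 𝔼 3 := vec3 x y ℓ with hvdef
  set v1 := mulVecE (nMat (nCoef A 1) (nCoef A 2)) v with hv1
  set v2 := mulVecE (uMat (wordCoef A 4)) v1 with hv2
  set v3 := mulVecE (loMat (wordCoef A 3)) v2 with hv3
  set v4 := mulVecE (uMat (wordCoef A 2)) v3 with hv4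
  set v5 := mulVecE (loMat (wordCoef A 1)) v4 with hv5
  have b0 : |v 1| < (2 * B) ^ 0 * tubeRad A ∧ |v 2| < (2 * B) ^ 0 * tubeRad A := by
    simp only [pow_zero, one_mul, hvdef, vec3_apply_one, vec3_apply_two]; exact ⟨hy, hℓ⟩
  have hpow : ∀ k : ℕ, 2 * B * ((2 * B) ^ k * tubeRad A) = (2 * B) ^ (k + 1) * tubeRad A := fun k ↦ by ring
  have b1 : |v1 1| < (2 * B) ^ 1 * tubeRad A ∧ |v1 2| < (2 * B) ^ 1 * tubeRad A := by
    rw [← hpow]; exact step_bound₁₂ hB (abs_nMat_le (abs_nCoef_le A).1 (abs_nCoef_le A).2 hB) rfl rfl b0.1 b0.2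
  have b2 : |v2 1| < (2 * B) ^ 2 * tubeRad A ∧ |v2 2| < (2 * B) ^ 2 * tubeRad A := by
    rw [← hpow]; exact step_bound₁₂ hB (abs_uMat_le (abs_wordCoef_le A 4) hB) rfl rfl b1.1 b1.2
  have b3 : |v3 1| < (2 * B) ^ 3 * tubeRad A ∧ |v3 2| < (2 * B) ^ 3 * tubeRad A := by
    rw [← hpow]; exact step_bound₁₂ hB (abs_loMat_le (abs_wordCoef_le A 3) hB) rfl rfl b2.1 b2.2
  have b4 : |v4 1| < (2 * B) ^ 4 * tubeRad A ∧ |v4 2| < (2 * B) ^ 4 * tubeRad A := by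
    rw [← hpow]; exact step_bound₁₂ hB (abs_uMat_le (abs_wordCoef_le A 2) hB) rfl rfl b3.1 b3.2
  have b5 : |v5 1| < (2 * B) ^ 5 * tubeRad A ∧ |v5 2| < (2 * B) ^ 5 * tubeRad A := by
    rw [← hpow]; exact step_bound₁₂ hB (abs_loMat_le (abs_wordCoef_le A 1) hB) rfl rfl b4.1 b4.2
  have lt1 : ∀ {k : ℕ} (hk : k ≤ 6) {a : ℝ}, |a| < (2 * B) ^ k * tubeRad A → |a| < 1 := by
    intro k hk a ha
    exact ha.trans_le ((hR hk).trans (by norm_num))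
  have hstage : (sigmaD A).toFun 1 (expT v) = (uDiffeotopy (wordCoef A 0)).toFun 1
      ((loDiffeotopy (wordCoef A 1)).toFun 1 ((uDiffeotopy (wordCoef A 2)).toFun 1
        ((loDiffeotopy (wordCoef A 3)).toFun 1 ((uDiffeotopy (wordCoef A 4)).toFun 1
          ((nDiffeotopy (nCoef A 1) (nCoef A 2)).toFun 1 (expT v)))))) := by
    simp only [sigmaD, Diffeotopy.trans_toFun, comp_apply]
  rw [hstage, nDiffeotopy_toFun_expT _ _ 1 (lt1 (by norm_num) b0.1) (lt1 (by norm_num) b0.2), hμ1, one_mul,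
    one_mul, ← hv1, uDiffeotopy_toFun_expT _ 1 (lt1 (by norm_num) b1.2), hμ1, one_mul, ← hv2,
    loDiffeotopy_toFun_expT _ 1 (lt1 (by norm_num) b2.1), hμ1, one_mul, ← hv3,
    uDiffeotopy_toFun_expT _ 1 (lt1 (by norm_num) b3.2), hμ1, one_mul, ← hv4,
    loDiffeotopy_toFun_expT _ 1 (lt1 (by norm_num) b4.1), hμ1, one_mul, ← hv5,
    uDiffeotopy_toFun_expT _ 1 (lt1 (by norm_num) b5.2), hμ1, one_mul]
  congr 1
  rw [← kWord_mul_nMat hA]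
  simp only [hv5, hv4, hv3, hv2, hv1, mulVecE_mulVecE, kWord, blockWord, Matrix.mul_assoc]

/-- `L⁻¹` on `T³`: `(u₁, u₂, u₃) ↦ (u₃⁻¹, u₂, u₁ u₃²)`. [folklore] -/
theorem torusMap_lMatInv (u : ThreeTorus) :
    torusMap (lMatInv : Matrix (Fin 3) (Fin 3) ℤ) u = (u.2.2⁻¹, u.2.1, u.1 * (u.2.2 * u.2.2)) := by
  simp [torusMap, torusMonomial, lMatInv, Fin.prod_univ_three, zpow_ofNat, sq]

/-- A point of `T³` is `expT` of its arguments. [folklore] -/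
theorem expT_vec3_arg (z : ThreeTorus) :
    expT (vec3 (arg (z.1 : ℂ)) (arg (z.2.1 : ℂ)) (arg (z.2.2 : ℂ))) = z := by
  rw [expT_vec3, Circle.exp_arg, Circle.exp_arg, Circle.exp_arg]

/-- **The monodromy of the tube straightening on the tube `|arg z₂|, |arg z₃| < r` is the tube
shear**, for every first coordinate. [cite: GompfAGT2010, §2 ¶1 and Thm 2.1 (hypotheses)] -/
theorem tubeStraightening_monodromy_apply (hA : IsGompfStandardForm A) {z : ThreeTorus}
    (hy : |arg (z.2.1 : ℂ)| < tubeRad A) (hℓ : |arg (z.2.2 : ℂ)| < tubeRad A) :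
    (tubeStraightening A hA).monodromy z = tubeShear z := by
  have hσ := sigmaD_one_expT A hA (x := arg (z.1 : ℂ)) hy hℓ
  rw [expT_vec3_arg] at hσ
  have hK : torusDiffeomorph (kMat A) ((sigmaD A).toFun 1 z) = z := by
    rw [hσ, torusDiffeomorph_expT, mulVecE_mulVecE, slRealMatrix_mul_inv, mulVecE_one, expT_vec3_arg]
  have hD : (tsD A).toFun 1 z = (torusDiffeomorph (kMat A)).symm (eDiffeotopy.toFun 1 z) := by
    simp only [tsD, Diffeotopy.trans_toFun, comp_apply, Diffeotopy.conj_toFun, hK]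
  have hE : eDiffeotopy.toFun 1 z = (z.1 * Circle.exp (sawArg (z.1 * z.2.2)), z.2.1,
      z.2.2 * Circle.exp (-sawArg (z.1 * z.2.2))) := by
    rw [eDiffeotopy, shiftDiffeotopy_toFun]
    show triShift 1 0 (-1) (μT 1 * 1 * sawArg (z.1 * z.2.2)) z = _
    simp [triShift, μT, Real.smoothTransition.one]
  show torusDiffeomorph A ((tsD A).toFun 1 z) = tubeShear z
  rw [hD, coe_torusDiffeomorph, show ((torusDiffeomorph (kMat A)).symm : ThreeTorus → ThreeTorus) =
      torusMap (((kMat A)⁻¹ : Matrix.SpecialLinearGroup (Fin 3) ℤ) : Matrix (Fin 3) (Fin 3) ℤ) from rfl,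
    ← comp_apply (f := torusMap _), ← torusMap_mul, ← Matrix.SpecialLinearGroup.coe_mul, mul_kMat_inv,
    torusMap_lMatInv, hE, tubeShear, shearF]
  have h1 := Circle.coe_ne_zero z.1
  have h3 := Circle.coe_ne_zero z.2.2
  have he := Circle.coe_ne_zero (Circle.exp (sawArg (z.1 * z.2.2)))
  refine Prod.ext ?_ (Prod.ext rfl ?_)
  · apply Subtype.ext
    simp only [Circle.exp_neg, Circle.coe_mul, Circle.coe_inv]
    field_simp
  · apply Subtype.ext
    simp only [Circle.exp_neg, Circle.coe_mul, Circle.coe_inv]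
    field_simp

/-- **On the tube and off the seam arc `1 < arg(z₁ z₃) < 2` the monodromy is the identity.** [folklore] -/
theorem tubeStraightening_monodromy_eq_self (hA : IsGompfStandardForm A) {z : ThreeTorus}
    (hy : |arg (z.2.1 : ℂ)| < tubeRad A) (hℓ : |arg (z.2.2 : ℂ)| < tubeRad A)
    (hn : arg ((z.1 * z.2.2 : Circle) : ℂ) ≤ 1 ∨ 2 ≤ arg ((z.1 * z.2.2 : Circle) : ℂ)) :
    (tubeStraightening A hA).monodromy z = z := by
  rw [tubeStraightening_monodromy_apply A hA hy hℓ]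
  exact tubeShear_eq_self (hn.elim shearF_eq_one_of_arg_le_one shearF_eq_one_of_two_le_arg)

/-! #### The other straightening class: the axis twist does not change the monodromy on the tube -/

/-- **The axis full turn is the identity within `|arg z₂|, |arg z₃| < 1/4` of `α`**, so the axis
twist of a straightening has the same monodromy there. [cite: GompfAGT2010, §4 ¶3 (the two isotopies differ by a full twist in the normal bundle of the curve)] -/
theorem Straightening.axisTwist_monodromy_apply_of_tube {A : Matrix.SpecialLinearGroup (Fin 3) ℤ}
    (S : Straightening A) {z : ThreeTorus} (hy : |arg (z.2.1 : ℂ)| < 1 / 4) (hℓ : |arg (z.2.2 : ℂ)| < 1 / 4) :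
    S.axisTwist.monodromy z = S.monodromy z := by
  have h1 : axisTwistDiffeotopy.toFun 1 z = z := by
    have hsq : (logT z) 1 ^ 2 + (logT z) 2 ^ 2 ≤ 1 / 4 := by
      have a1 : |(logT z) 1| < 1 / 4 := by rw [logT_apply]; exact hy
      have a2 : |(logT z) 2| < 1 / 4 := by rw [logT_apply]; exact hℓ
      have b1 := abs_lt.1 a1
      have b2 := abs_lt.1 a2
      nlinarith
    show torusPush (axisRotFun 1) z = z
    rw [torusPush, axisRotFun_one_of_le hsq, expT_logT]
  show torusDiffeomorph A ((axisTwistDiffeotopy.trans S.reparam.D).toFun 1 z) =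
    torusDiffeomorph A (S.D.toFun 1 z)
  rw [Diffeotopy.trans_toFun, comp_apply, h1]
  show torusDiffeomorph A ((S.D.reparam Real.smoothTransition Real.smoothTransition.contDiff
    Real.smoothTransition.zero).toFun 1 z) = _
  rw [Diffeotopy.reparam_toFun, Real.smoothTransition.one]

/-- **Both straightening classes with the tube shear as monodromy on the tube.** For `A` in
standard form and `S₀ = tubeStraightening A`: the monodromies of `S₀` and of `S₀.axisTwist`
agree with `tubeShear` on `|arg z₂|, |arg z₃| < r`, and every framing path of `A` is homotopic to
the path of `S₀.reparam` (same monodromy as `S₀`, `Straightening.reparam_monodromy`) or of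
`S₀.axisTwist` (`Straightening.homotopic_reparam_or_axisTwist`). [cite: GompfAGT2010, §4 ¶2–¶3] -/
theorem exists_straightening_tubeShear (hA : IsGompfStandardForm A) (γ : SmoothMatrixPath (slRealMatrix A)) :
    ∃ S : Straightening A, γ.toPath.Homotopic S.path.toPath ∧ S.R ≤ tubeRad A ∧
      ∀ z : ThreeTorus, |arg (z.2.1 : ℂ)| < tubeRad A → |arg (z.2.2 : ℂ)| < tubeRad A →
        S.monodromy z = tubeShear z := by
  set S₀ := tubeStraightening A hA
  have hq := tubeRad_le_quarter A
  rcases S₀.homotopic_reparam_or_axisTwist γ with h | h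
  · refine ⟨S₀.reparam, h, tsRad_le_tubeRad A, fun z hy hℓ ↦ ?_⟩
    rw [Straightening.reparam_monodromy]
    exact tubeStraightening_monodromy_apply A hA hy hℓ
  · refine ⟨S₀.axisTwist, h, ?_, fun z hy hℓ ↦ ?_⟩
    · show S₀.twistRad ≤ tubeRad A
      have h1 : S₀.twistRad ≤ S₀.R / 2 := min_le_left _ _
      have h2 : S₀.R = tsRad A := rfl
      have h3 := tsRad_le_tubeRad A
      have h4 := tsRad_pos A
      linarith
    · rw [S₀.axisTwist_monodromy_apply_of_tube (hy.trans_le hq) (hℓ.trans_le hq)]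
      exact tubeStraightening_monodromy_apply A hA hy hℓ

end Monodromy

end Literature.Topology.FourManifolds
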